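import Literature.NumberTheory.LFunctions.HuxleyLargeValues
import Literature.NumberTheory.LFunctions.HuxleyZeroDetection
import Literature.NumberTheory.LFunctions.ZetaOneLineBounds
import Mathlib.Analysis.InnerProductSpace.PiL2
import HarnessLib

/-!
# Huxley's large-values theorem (27.27): proof

Trunk T-ANT (`Literature/NumberTheory/LFunctions`), family RH. Sixth file of the decomposition of
the named fact `Literature.NumberTheory.LFunctions.zeroDensity_huxley`: the DISCHARGE `Literature.NumberTheory.LFunctions.Huxley1972_largeValues_holds` of the
named fact `Literature.NumberTheory.LFunctions.Huxley1972_largeValues` of `HuxleyLargeValues.lean` — Huxley, *The Distribution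
of Prime Numbers* (1972), Ch. 27, THEOREM (27.24)–(27.27): if `|∑_{m ≤ N} a(m) m^{-s_r}| ≥ V` at
points `s_r = σ_r + it_r`, `0 ≤ σ_r ≤ 1/3`, `log N ≤ |t_r − t_q| ≤ T` (`q ≠ r`), then
`R ≤ C (GNV⁻² + G³NTV⁻⁶ log⁴(NT))` with an absolute constant (here `C = 2⁹¹`). Everything in this
file is PROVED; the proof is Huxley's (pp. 74–76):

* **§1 `|ζ(λ+iτ)| ≪ |τ|^{1/2} log|τ|` uniformly in `0 < λ ≤ 11/12`** (`norm_zeta_le_sqrt`, the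
  exponent-`1/2` consequence of (27.17)–(27.19)): for `λ ≥ 1/2` from the simplest approximate
  formula, Titchmarsh (3.5.3) (tree: `Literature.NumberTheory.LFunctions.ZetaOneLine.riemannZeta_eq_sum_add_sub_integral`),
  for `λ < 1/2` by the functional equation (Mathlib `riemannZeta_one_sub`) and the bound for its
  factor (tree: `Literature.Analysis.SpecialFunctions.GammaVert.norm_fe_factor_le`).
* **§2 the scalar products (27.13)–(27.20)**: Mellin's formula
  `∑ e^{-2m/N} m^{-s} = (2πi)⁻¹ ∫_{(2)} Γ(w)(N/2)^w ζ(w+s) dw` and the shift of the line of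
  integration. Huxley moves to the imaginary axis with a small semicircle around the pole of
  `Γ` at `0`; here the line `re w = κ = min(1/log N, 1/4)` is used instead (so that only the pole
  of `ζ(s+w)` at `w = 1 − s` is crossed, with the residue (27.14), bounded when `|t| ≥ log N`,
  and `(N/2)^κ ≤ e`), via `Literature.NumberTheory.LFunctions.HuxleyZeroDetection.integral_vertical_sub_eq_of_pole`; the outcome
  `norm_expSum_le` is (27.20) in the form `≪ (1 + log N)(3+|t|)^{1/2}(1 + log(3+|t|))`.
* **§3 Montgomery's vectors (27.9)–(27.12)** in `ℂ^{N²}` (`EuclideanSpace ℂ (Fin (N²))`, the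
  truncation at `N²` costing `≤ 1` in the scalar products): `(u, f^{(s)}) = ∑ a(m)m^{-s}`,
  `‖u‖² ≤ e²G`, `‖f^{(s)}‖² ≤ N`, `|(f^{(s₁)}, f^{(s₂)})| ≤ 2³³(1+log N)(3+|t|)^{1/2}(1+log(3+|t|))`.
* **§4 Halász's lemma** (`Literature.NumberTheory.LFunctions.halasz_lemma`, `HuxleyLargeValues.lean`) on windows of length `T₀`
  and the subdivision (27.21)–(27.23). With `X = V²/(2e²G K₁)`, `K₁ = 2³³(1+log N)(1+log(3+T))`:
  if `X² ≥ 6` the windows have length `X²/2` and the proviso (27.7) holds; otherwise windows of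
  length `(log N)/2` contain single points and Halász's lemma applies with `B = 0`; in both cases
  a window holds `≤ 2e²GNV⁻²` points and there are `≤ 2T/ℓ + 1` windows, and
  `(1+log N)(1+log(3+T)) ≤ 9 log²(NT)` gives (27.27).

## Main statements (all proved)

* `Literature.NumberTheory.LFunctions.HuxleyLV.norm_zeta_le_sqrt`, `Literature.NumberTheory.LFunctions.HuxleyLV.norm_expSum_le`, `Literature.NumberTheory.LFunctions.HuxleyLV.inner_uVec_fVec`,
  `Literature.NumberTheory.LFunctions.HuxleyLV.norm_inner_fVec_le`, `Literature.NumberTheory.LFunctions.HuxleyLV.card_window_le`, `Literature.NumberTheory.LFunctions.HuxleyLV.largeValues_holds`.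
* `Literature.Huxley1972_largeValues_holds : Huxley1972_largeValues`.

## References

* M. N. Huxley, *The Distribution of Prime Numbers. Large Sieves and Zero-Density Theorems*, Oxford
  1972, Ch. 27, (27.1)–(27.27).
* H. L. Montgomery, *Mean and large values of Dirichlet polynomials*, Invent. Math. 8 (1969), 334–345
  (not consulted).
* E. C. Titchmarsh, *The Theory of the Riemann Zeta-Function*, 2nd ed. 1986, §3.5 (3.5.3), §4.12.
-/

noncomputable section

open Real Set Filter Topology Complex MeasureTheory Finset
open scoped ComplexConjugate InnerProductSpace

namespace Literature.NumberTheory.LFunctions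

namespace HuxleyLV

open HuxleyZeroDetection

/-! ## §1. `|ζ(λ + iτ)| ≪ |τ|^{1/2} log|τ|` uniformly in `0 < λ ≤ 1` (Huxley (27.17)–(27.19)) -/

/-- `∑_{n ≤ N} n^{-σ} ≤ N^{1−σ} (1 + log N)` for `0 ≤ σ ≤ 1`. [folklore] -/
theorem sum_rpow_neg_le {σ : ℝ} (hσ1 : σ ≤ 1) {N : ℕ} (hN : 1 ≤ N) :
    ∑ n ∈ Finset.Icc 1 N, (n : ℝ) ^ (-σ) ≤ (N : ℝ) ^ (1 - σ) * (1 + Real.log N) := by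
  have hN0 : (0 : ℝ) < N := by exact_mod_cast hN
  have h1 : ∀ n ∈ Finset.Icc 1 N, (n : ℝ) ^ (-σ) ≤ (N : ℝ) ^ (1 - σ) * (n : ℝ)⁻¹ := by
    intro n hn
    rw [Finset.mem_Icc] at hn
    have hn0 : (0 : ℝ) < n := by exact_mod_cast hn.1
    have : (n : ℝ) ^ (-σ) = (n : ℝ) ^ (1 - σ) * (n : ℝ)⁻¹ := by
      rw [← Real.rpow_neg_one, ← Real.rpow_add hn0]; ring_nf
    rw [this]
    exact mul_le_mul_of_nonneg_right (Real.rpow_le_rpow hn0.le (by exact_mod_cast hn.2) (by linarith))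
      (by positivity)
  have h2 : ∑ n ∈ Finset.Icc 1 N, (n : ℝ)⁻¹ ≤ 1 + Real.log N := by
    have := harmonic_le_one_add_log N
    simpa [harmonic_eq_sum_Icc] using this
  calc ∑ n ∈ Finset.Icc 1 N, (n : ℝ) ^ (-σ) ≤ ∑ n ∈ Finset.Icc 1 N, (N : ℝ) ^ (1 - σ) * (n : ℝ)⁻¹ :=
        Finset.sum_le_sum h1
    _ = (N : ℝ) ^ (1 - σ) * ∑ n ∈ Finset.Icc 1 N, (n : ℝ)⁻¹ := by rw [Finset.mul_sum]
    _ ≤ _ := mul_le_mul_of_nonneg_left h2 (by positivity)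

/-- **The trivial bound in `1/2 ≤ σ ≤ 1`** (from the simplest approximate formula, Titchmarsh
(3.5.3) with `N = ⌊|t|⌋`): for `|t| ≥ 3`, `‖ζ(σ+it)‖ ≤ 10 |t|^{1−σ} (1 + log|t|)`
(Huxley (27.17) is the sharper mean-square form; this suffices for (27.19) at exponent `1/2`).
[cite: Titchmarsh1986, §3.5 eq. (3.5.3)] -/
theorem norm_zeta_le_rpow_log {s : ℂ} (hσ0 : 1 / 2 ≤ s.re) (hσ1 : s.re ≤ 1) (ht : 3 ≤ |s.im|) :
    ‖riemannZeta s‖ ≤ 10 * |s.im| ^ (1 - s.re) * (1 + Real.log |s.im|) := by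
  set t := s.im with htdef
  set σ := s.re with hσdef
  have hσpos : 0 < σ := by linarith
  have hs1 : s ≠ 1 := by
    intro h
    have : t = 0 := by rw [htdef, h]; simp
    rw [this, abs_zero] at ht; linarith
  set N : ℕ := ⌊|t|⌋₊ with hNdef
  have hN3 : 3 ≤ N := Nat.le_floor (by simpa using ht)
  have hN1 : 1 ≤ N := le_trans (by norm_num) hN3
  have hNt : (N : ℝ) ≤ |t| := Nat.floor_le (abs_nonneg t)
  have hNt' : |t| / 2 ≤ N := by
    have := Nat.lt_floor_add_one |t|; rw [← hNdef] at this; linarith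
  have hN0 : (0 : ℝ) < N := by exact_mod_cast (lt_of_lt_of_le (by norm_num) hN3)
  have ht0 : 0 < |t| := by linarith
  have hL0 : 0 ≤ Real.log |t| := Real.log_nonneg (by linarith)
  have hformula := ZetaOneLine.riemannZeta_eq_sum_add_sub_integral (by simpa using hσpos) hs1 hN1
  have htpow : ∀ x : ℝ, 0 < |t| ^ x := fun x ↦ Real.rpow_pos_of_pos ht0 x
  -- (a) the partial sum
  have ha : ‖∑ n ∈ Finset.Icc 1 N, (n : ℂ) ^ (-s)‖ ≤ |t| ^ (1 - σ) * (1 + Real.log |t|) := by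
    calc ‖∑ n ∈ Finset.Icc 1 N, (n : ℂ) ^ (-s)‖ ≤ ∑ n ∈ Finset.Icc 1 N, (n : ℝ) ^ (-σ) := by
          refine (norm_sum_le _ _).trans (Finset.sum_le_sum fun n hn ↦ ?_)
          rw [Finset.mem_Icc] at hn
          rw [norm_natCast_cpow_of_pos hn.1, neg_re]
      _ ≤ (N : ℝ) ^ (1 - σ) * (1 + Real.log N) := sum_rpow_neg_le hσ1 hN1
      _ ≤ |t| ^ (1 - σ) * (1 + Real.log |t|) := by
          have h3 : Real.log N ≤ Real.log |t| := Real.log_le_log hN0 hNt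
          have hlN : 0 ≤ Real.log N := Real.log_nonneg (by exact_mod_cast hN1)
          exact mul_le_mul (Real.rpow_le_rpow hN0.le hNt (by linarith)) (by linarith) (by positivity)
            (by positivity)
  -- (b) the term `N^{1-s}/(s-1)`
  have hb : ‖(N : ℂ) ^ (1 - s) / (s - 1)‖ ≤ |t| ^ (1 - σ) := by
    rw [norm_div, norm_natCast_cpow_of_pos (by omega), sub_re, one_re, ← hσdef]
    have hs1norm : |t| ≤ ‖s - 1‖ := by
      have := abs_im_le_norm (s - 1); simpa [← htdef] using this
    have hNpow : (N : ℝ) ^ (1 - σ) ≤ |t| ^ (1 - σ) := Real.rpow_le_rpow hN0.le hNt (by linarith)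
    calc (N : ℝ) ^ (1 - σ) / ‖s - 1‖ ≤ |t| ^ (1 - σ) / |t| := by
          gcongr
      _ ≤ |t| ^ (1 - σ) / 1 := div_le_div_of_nonneg_left (by positivity) one_pos (by linarith)
      _ = _ := div_one _
  -- (c) the tail integral
  have hc : ‖s * ∫ x in Ioi (N : ℝ), ((Int.fract x : ℝ) : ℂ) * (x : ℂ) ^ (-(s + 1))‖ ≤ 8 * |t| ^ (1 - σ) := by
    rw [norm_mul]
    have h1 := ZetaOneLine.norm_integral_Ioi_fract_mul_cpow_le (s := s) (by simpa using hσpos)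
      (show (1 : ℝ) ≤ N by exact_mod_cast hN1)
    rw [← hσdef] at h1
    have hsn : ‖s‖ ≤ σ + |t| := by
      have := Complex.norm_le_abs_re_add_abs_im s
      rwa [← hσdef, ← htdef, abs_of_pos hσpos] at this
    have hsn2 : ‖s‖ ≤ 2 * |t| := by linarith
    -- `N^{-σ} ≤ (|t|/2)^{-σ} ≤ 2 |t|^{-σ}`
    have hNσ : (N : ℝ) ^ (-σ) ≤ 2 * |t| ^ (-σ) := by
      calc (N : ℝ) ^ (-σ) ≤ (|t| / 2) ^ (-σ) := Real.rpow_le_rpow_of_nonpos (by positivity) hNt' (by linarith)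
        _ = |t| ^ (-σ) * 2 ^ σ := by
            rw [Real.div_rpow ht0.le (by norm_num), Real.rpow_neg (by norm_num : (0:ℝ) ≤ 2), div_inv_eq_mul]
        _ ≤ |t| ^ (-σ) * 2 ^ (1 : ℝ) := by
            gcongr; norm_num
        _ = 2 * |t| ^ (-σ) := by rw [Real.rpow_one]; ring
    have hint0 : 0 ≤ ‖∫ x in Ioi (N : ℝ), ((Int.fract x : ℝ) : ℂ) * (x : ℂ) ^ (-(s + 1))‖ := norm_nonneg _
    calc ‖s‖ * ‖∫ x in Ioi (N : ℝ), ((Int.fract x : ℝ) : ℂ) * (x : ℂ) ^ (-(s + 1))‖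
        ≤ (2 * |t|) * ((N : ℝ) ^ (-σ) / σ) := mul_le_mul hsn2 h1 hint0 (by positivity)
      _ ≤ (2 * |t|) * (2 * |t| ^ (-σ) / (1 / 2)) := by gcongr
      _ = 8 * (|t| ^ (1 : ℝ) * |t| ^ (-σ)) := by rw [Real.rpow_one]; ring
      _ = 8 * |t| ^ (1 - σ) := by rw [← Real.rpow_add ht0]; ring_nf
  calc ‖riemannZeta s‖ = ‖∑ n ∈ Finset.Icc 1 N, (n : ℂ) ^ (-s) + (N : ℂ) ^ (1 - s) / (s - 1) -
        s * ∫ x in Ioi (N : ℝ), ((Int.fract x : ℝ) : ℂ) * (x : ℂ) ^ (-(s + 1))‖ := by rw [hformula]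
    _ ≤ ‖∑ n ∈ Finset.Icc 1 N, (n : ℂ) ^ (-s)‖ + ‖(N : ℂ) ^ (1 - s) / (s - 1)‖ +
        ‖s * ∫ x in Ioi (N : ℝ), ((Int.fract x : ℝ) : ℂ) * (x : ℂ) ^ (-(s + 1))‖ := norm_sub_le_of_le (norm_add_le _ _) le_rfl
    _ ≤ |t| ^ (1 - σ) * (1 + Real.log |t|) + |t| ^ (1 - σ) + 8 * |t| ^ (1 - σ) := by gcongr
    _ ≤ 10 * |t| ^ (1 - σ) * (1 + Real.log |t|) := by nlinarith [htpow (1 - σ)]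

/-- **Below the critical line, by the functional equation** (Huxley (27.18): "The functional
equation and the estimate (20.4) now give `|ζ(λ+iτ)|² ≪ |τ|^{1−λ} log²|τ|`"; here in the weaker
form with exponent `1/2`): for `0 < λ < 1/2`, `|τ| ≥ 3`,
`‖ζ(λ+iτ)‖ ≤ 80π² (1+|τ|)^{1/2} (1 + log|τ|)`. [cite: Huxley1972, Ch. 27, (27.18)–(27.19)] -/
theorem norm_zeta_le_of_re_lt_half {s : ℂ} (hσ0 : 0 < s.re) (hσ1 : s.re < 1 / 2) (ht : 3 ≤ |s.im|) :
    ‖riemannZeta s‖ ≤ 80 * π ^ 2 * (1 + |s.im|) ^ (1 / 2 : ℝ) * (1 + Real.log |s.im|) := by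
  -- `s = 1 - s'` with `s' = 1 - s`, `re s' ∈ (1/2, 1)`
  set s' : ℂ := 1 - s with hs'
  have hre : s'.re = 1 - s.re := by simp [hs']
  have him : s'.im = -s.im := by simp [hs']
  have ht' : 3 ≤ |s'.im| := by rw [him, abs_neg]; exact ht
  have hs'0 : ∀ n : ℕ, s' ≠ -n := by
    intro n h
    have := congrArg Complex.im h
    rw [him] at this; simp at this
    rw [this, abs_zero] at ht; linarith
  have hs'1 : s' ≠ 1 := by
    intro h; have := congrArg Complex.re h; rw [hre] at this; simp at this; linarith
  have hfe := riemannZeta_one_sub hs'0 hs'1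
  rw [show 1 - s' = s by rw [hs']; ring] at hfe
  rw [hfe, norm_mul]
  have hfac := Literature.Analysis.SpecialFunctions.GammaVert.norm_fe_factor_le (s := s') (by rw [hre]; linarith) (by rw [hre]; linarith)
  have hζ := norm_zeta_le_rpow_log (s := s') (by rw [hre]; linarith) (by rw [hre]; linarith) ht'
  rw [him, abs_neg, hre] at hζ hfac
  rw [show (1 : ℝ) - (1 - s.re) = s.re by ring] at hζ
  have ht0 : 0 < |s.im| := by linarith
  have hL0 : 0 ≤ Real.log |s.im| := Real.log_nonneg (by linarith)
  have h1 : (1 + |s.im|) ^ (1 - s.re - 1 / 2) * |s.im| ^ s.re ≤ (1 + |s.im|) ^ (1 / 2 : ℝ) := by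
    calc (1 + |s.im|) ^ (1 - s.re - 1 / 2) * |s.im| ^ s.re
        ≤ (1 + |s.im|) ^ (1 - s.re - 1 / 2) * (1 + |s.im|) ^ s.re := by
          gcongr; linarith
      _ = (1 + |s.im|) ^ (1 / 2 : ℝ) := by rw [← Real.rpow_add (by positivity)]; ring_nf
  calc ‖2 * (2 * (π : ℂ)) ^ (-s') * Complex.Gamma s' * Complex.cos (π * s' / 2)‖ * ‖riemannZeta s'‖
      ≤ (8 * π ^ 2 * (1 + |s.im|) ^ (1 - s.re - 1 / 2)) * (10 * |s.im| ^ s.re * (1 + Real.log |s.im|)) :=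
        mul_le_mul hfac hζ (norm_nonneg _) (by positivity)
    _ = 80 * π ^ 2 * ((1 + |s.im|) ^ (1 - s.re - 1 / 2) * |s.im| ^ s.re) * (1 + Real.log |s.im|) := by ring
    _ ≤ 80 * π ^ 2 * (1 + |s.im|) ^ (1 / 2 : ℝ) * (1 + Real.log |s.im|) := by gcongr

/-- Near the real axis: `‖ζ(s)‖ ≤ 16` for `0 ≤ re s ≤ 11/12`, `|im s| ≤ 3` (Euler–Maclaurin).
[folklore] -/
theorem norm_zeta_le_sixteen {s : ℂ} (hσ0 : 0 ≤ s.re) (hσ1 : s.re ≤ 11 / 12) (ht : |s.im| ≤ 3) :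
    ‖riemannZeta s‖ ≤ 16 := by
  have hs1 : s ≠ 1 := by
    intro h; rw [h] at hσ1; norm_num at hσ1
  have h := LFunctions.norm_riemannZeta_le_of_neg_one_le_re (by linarith) hs1
  have hn : ‖s‖ ≤ 4 := by
    refine (norm_le_abs_re_add_abs_im s).trans ?_
    rw [abs_of_nonneg hσ0]; linarith
  have hn1 : ‖s + 1‖ ≤ 5 := by
    refine (norm_le_abs_re_add_abs_im _).trans ?_
    have : |(s + 1).re| ≤ 2 := by simp; rw [abs_of_nonneg (by linarith)]; linarith
    simp at this ⊢; linarith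
  have hn2 : ‖s + 2‖ ≤ 6 := by
    refine (norm_le_abs_re_add_abs_im _).trans ?_
    have : |(s + 2).re| ≤ 3 := by simp; rw [abs_of_nonneg (by linarith)]; linarith
    simp at this ⊢; linarith
  have hinv : 1 / ‖s - 1‖ ≤ 12 := by
    have : 1 / 12 ≤ ‖s - 1‖ := by
      have := abs_re_le_norm (s - 1)
      simp only [sub_re, one_re] at this
      have h' : 1 / 12 ≤ |s.re - 1| := by rw [abs_of_nonpos (by linarith)]; linarith
      linarith
    rw [div_le_iff₀ (by linarith)]; linarith
  have hprod : ‖s‖ * ‖s + 1‖ * ‖s + 2‖ ≤ 4 * 5 * 6 :=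
    mul_le_mul (mul_le_mul hn hn1 (norm_nonneg _) (by norm_num)) hn2 (norm_nonneg _) (by norm_num)
  calc ‖riemannZeta s‖ ≤ 1 / ‖s - 1‖ + 1 / 2 + ‖s‖ / 12 + ‖s‖ * ‖s + 1‖ * ‖s + 2‖ / 48 := h
    _ ≤ 12 + 1 / 2 + 4 / 12 + 4 * 5 * 6 / 48 := by gcongr
    _ ≤ 16 := by norm_num

/-- **Huxley (27.19), weak form: `|ζ(λ + iτ)| ≤ 800 (3+|τ|)^{1/2} (1 + log(3+|τ|))` uniformly in
`0 < λ ≤ 11/12`, all real `τ`.** [cite: Huxley1972, Ch. 27, (27.19)] -/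
theorem norm_zeta_le_sqrt {s : ℂ} (hσ0 : 0 < s.re) (hσ1 : s.re ≤ 11 / 12) :
    ‖riemannZeta s‖ ≤ 800 * (3 + |s.im|) ^ (1 / 2 : ℝ) * (1 + Real.log (3 + |s.im|)) := by
  have hπ : π ^ 2 < 10 := by nlinarith [Real.pi_lt_d2, Real.pi_pos]
  have h3 : (1 : ℝ) ≤ (3 + |s.im|) ^ (1 / 2 : ℝ) := Real.one_le_rpow (by linarith [abs_nonneg s.im]) (by norm_num)
  have hL3 : 1 ≤ 1 + Real.log (3 + |s.im|) := by
    have := Real.log_nonneg (show (1 : ℝ) ≤ 3 + |s.im| by linarith [abs_nonneg s.im]); linarith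
  rcases le_or_gt |s.im| 3 with ht | ht
  · calc ‖riemannZeta s‖ ≤ 16 := norm_zeta_le_sixteen hσ0.le hσ1 ht
      _ = 16 * 1 * 1 := by ring
      _ ≤ 800 * (3 + |s.im|) ^ (1 / 2 : ℝ) * (1 + Real.log (3 + |s.im|)) := by gcongr; norm_num
  · have ht0 : 0 < |s.im| := by linarith
    have hlog : Real.log |s.im| ≤ Real.log (3 + |s.im|) := Real.log_le_log ht0 (by linarith)
    have hL0 : 0 ≤ Real.log |s.im| := Real.log_nonneg (by linarith)
    rcases lt_or_ge s.re (1 / 2) with hlt | hge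
    · have h := norm_zeta_le_of_re_lt_half hσ0 hlt ht.le
      have h1 : (1 + |s.im|) ^ (1 / 2 : ℝ) ≤ (3 + |s.im|) ^ (1 / 2 : ℝ) :=
        Real.rpow_le_rpow (by positivity) (by linarith) (by norm_num)
      calc ‖riemannZeta s‖ ≤ 80 * π ^ 2 * (1 + |s.im|) ^ (1 / 2 : ℝ) * (1 + Real.log |s.im|) := h
        _ ≤ 80 * 10 * (3 + |s.im|) ^ (1 / 2 : ℝ) * (1 + Real.log (3 + |s.im|)) := by gcongr
        _ = _ := by norm_num
    · have h := norm_zeta_le_rpow_log hge (by linarith) ht.le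
      have h1 : |s.im| ^ (1 - s.re) ≤ (3 + |s.im|) ^ (1 / 2 : ℝ) := by
        calc |s.im| ^ (1 - s.re) ≤ |s.im| ^ (1 / 2 : ℝ) :=
              Real.rpow_le_rpow_of_exponent_le (by linarith) (by linarith)
          _ ≤ (3 + |s.im|) ^ (1 / 2 : ℝ) := Real.rpow_le_rpow (by positivity) (by linarith) (by norm_num)
      calc ‖riemannZeta s‖ ≤ 10 * |s.im| ^ (1 - s.re) * (1 + Real.log |s.im|) := h
        _ ≤ 10 * (3 + |s.im|) ^ (1 / 2 : ℝ) * (1 + Real.log (3 + |s.im|)) := by gcongr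
        _ ≤ 800 * (3 + |s.im|) ^ (1 / 2 : ℝ) * (1 + Real.log (3 + |s.im|)) := by gcongr; norm_num

end HuxleyLV

end Literature.NumberTheory.LFunctions

end

noncomputable section

open Real Set Filter Topology Complex MeasureTheory Finset
open scoped ComplexConjugate InnerProductSpace

namespace Literature.NumberTheory.LFunctions

namespace HuxleyLV

open HuxleyZeroDetection MeasureTheory

/-! ## §2. Mellin's formula for `∑ e^{-2m/N} m^{-s}` and the shift to `re w = κ` (Huxley (27.13)–(27.16)) -/

section MellinLV

open MellinBarnes (continuous_Gamma_line integrable_Gamma_two_line norm_ofReal_cpow integral_cpow_neg_mul_Gamma div_ofReal_cpow_neg)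

/-- Mellin's formula on `re w = 2` for bounded coefficients (`‖f n‖ ≤ C`, `re s > -1`):
`∫ Γ(2+iy) Y^{2+iy} L(f, s+2+iy) dy = 2π ∑ f(n) e^{-n/Y} n^{-s}`. [cite: Huxley1972, Ch. 23, (23.6)] -/
theorem integral_Gamma_cpow_LSeries_two_of_bounded {f : ℕ → ℂ} {C : ℝ} (hf : ∀ n, ‖f n‖ ≤ C)
    {Y : ℝ} (hY : 0 < Y) {s : ℂ} (hs : -1 < s.re) :
    ∫ y : ℝ, Complex.Gamma (2 + y * I) * (Y : ℂ) ^ (2 + y * I) * LSeries f (s + (2 + y * I)) =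
      2 * π * LSeries (smoothed f Y) s := by
  set F : ℕ → ℝ → ℂ := fun n y ↦ Complex.Gamma (2 + y * I) * (Y : ℂ) ^ (2 + y * I) *
    LSeries.term f (s + (2 + y * I)) n with hF
  have hC : 0 ≤ C := (norm_nonneg _).trans (hf 0)
  have hp : 1 < s.re + 2 := by linarith
  have hpt : ∀ y : ℝ, Complex.Gamma (2 + y * I) * (Y : ℂ) ^ (2 + y * I) * LSeries f (s + (2 + y * I)) =
      ∑' n, F n y := by
    intro y; rw [LSeries, ← tsum_mul_left]
  -- termwise norm bound
  have hnorm : ∀ n y, ‖F n y‖ ≤ Y ^ (2 : ℝ) * (C * (1 / (n : ℝ) ^ (s.re + 2))) * ‖Complex.Gamma (2 + y * I)‖ := by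
    intro n y
    rw [hF]; dsimp only
    rw [norm_mul, norm_mul, norm_ofReal_cpow hY, LSeries.norm_term_eq]
    have hre : (2 + (y : ℂ) * I).re = 2 := by simp
    have hre' : (s + (2 + (y : ℂ) * I)).re = s.re + 2 := by simp
    rw [hre, hre']
    split_ifs with hn
    · subst hn; simp only [mul_zero]; positivity
    · have h1 : ‖f n‖ / (n : ℝ) ^ (s.re + 2) ≤ C * (1 / (n : ℝ) ^ (s.re + 2)) := by
        rw [mul_one_div]; exact div_le_div_of_nonneg_right (hf n) (by positivity)
      have h0 : 0 ≤ ‖Complex.Gamma (2 + y * I)‖ * Y ^ (2 : ℝ) := by positivity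
      calc ‖Complex.Gamma (2 + y * I)‖ * Y ^ (2 : ℝ) * (‖f n‖ / (n : ℝ) ^ (s.re + 2))
          ≤ ‖Complex.Gamma (2 + y * I)‖ * Y ^ (2 : ℝ) * (C * (1 / (n : ℝ) ^ (s.re + 2))) :=
            mul_le_mul_of_nonneg_left h1 h0
        _ = _ := by ring
  have hint : ∀ n, Integrable (F n) := fun n ↦
    ((integrable_Gamma_two_line.norm.const_mul (Y ^ (2 : ℝ) * (C * (1 / (n : ℝ) ^ (s.re + 2))))).mono'
      (continuous_mellinTerm hY s n).aestronglyMeasurable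
      (Eventually.of_forall fun y ↦ by simpa [hF, mul_assoc] using hnorm n y))
  set LΓ : ℝ := ∫ y : ℝ, ‖Complex.Gamma (2 + y * I)‖ with hLΓ
  have hsum : Summable fun n ↦ ∫ y, ‖F n y‖ := by
    refine Summable.of_nonneg_of_le (fun n ↦ integral_nonneg fun y ↦ norm_nonneg _)
      (fun n ↦ ?_) (((Real.summable_one_div_nat_rpow.2 hp).mul_left (Y ^ (2 : ℝ) * C * LΓ)))
    calc ∫ y, ‖F n y‖
        ≤ ∫ y : ℝ, Y ^ (2 : ℝ) * (C * (1 / (n : ℝ) ^ (s.re + 2))) * ‖Complex.Gamma (2 + y * I)‖ :=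
          integral_mono (hint n).norm (integrable_Gamma_two_line.norm.const_mul _) fun y ↦ hnorm n y
      _ = Y ^ (2 : ℝ) * C * LΓ * (1 / (n : ℝ) ^ (s.re + 2)) := by rw [integral_const_mul, hLΓ]; ring
  have hval : ∀ n, ∫ y, F n y = 2 * π * LSeries.term (smoothed f Y) s n := by
    intro n
    rcases eq_or_ne n 0 with rfl | hn
    · simp [hF, LSeries.term_zero]
    · exact integral_mellinTerm hY s hn
  calc ∫ y : ℝ, Complex.Gamma (2 + y * I) * (Y : ℂ) ^ (2 + y * I) * LSeries f (s + (2 + y * I))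
      = ∫ y : ℝ, ∑' n, F n y := integral_congr_ae (Eventually.of_forall hpt)
    _ = ∑' n, ∫ y, F n y := (integral_tsum_of_summable_integral_norm hint hsum).symm
    _ = ∑' n, 2 * π * LSeries.term (smoothed f Y) s n := tsum_congr hval
    _ = 2 * π * LSeries (smoothed f Y) s := by rw [tsum_mul_left, LSeries]

/-- The coefficient sequence `↗ζ = (n ↦ (ζ(n) : ℂ))` of Mathlib's arithmetic function
`ArithmeticFunction.zeta` (`1` for `n ≥ 1`, `0` at `n = 0`, `ArithmeticFunction.zeta_apply`), whose
`L`-series is `riemannZeta` (Mathlib `ArithmeticFunction.LSeries_zeta_eq_riemannZeta`). This is an `abbrev` for `↗ζ`,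
kept as a short local name. [folklore] -/
abbrev one' : ℕ → ℂ := fun n ↦ ((ArithmeticFunction.zeta n : ℕ) : ℂ)

/-- `one' n = 1` for `n ≠ 0` (`ArithmeticFunction.zeta_apply`). [folklore] -/
theorem one'_of_ne_zero {n : ℕ} (hn : n ≠ 0) : one' n = 1 := by
  simp [one', ArithmeticFunction.zeta_apply, hn]

/-- `‖one'(n)‖ ≤ 1`. [folklore] -/
theorem norm_one'_le (n : ℕ) : ‖one' n‖ ≤ 1 := by
  rcases eq_or_ne n 0 with rfl | hn
  · simp [one']
  · rw [one'_of_ne_zero hn]; simp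

/-- The smoothed sum `S_N(s) = ∑_{m ≥ 1} e^{-2m/N} m^{-s}` (Huxley (27.13), left side). [cite: Huxley1972, Ch. 27, (27.13)] -/
def expSum (N : ℕ) (s : ℂ) : ℂ := LSeries (smoothed one' ((N : ℝ) / 2)) s

/-- The numerator `h(w) = Γ(w) (N/2)^w ζ₁(s + w)`, holomorphic on `re w > 0`. [cite: Huxley1972, Ch. 27, (27.13)] -/
def lvNum (s : ℂ) (N : ℕ) (w : ℂ) : ℂ :=
  Complex.Gamma w * (((N : ℝ) / 2 : ℝ) : ℂ) ^ w * riemannZeta₁ (s + w)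

/-- The integrand `Γ(w) (N/2)^w ζ(s+w) = h(w)/(w − (1 − s))`. [cite: Huxley1972, Ch. 27, (27.13)] -/
def lvIntegrand (s : ℂ) (N : ℕ) (w : ℂ) : ℂ := lvNum s N w / (w - (1 - s))

/-- Off the pole, `lvIntegrand s N w = Γ(w) (N/2)^w ζ(s+w)`. [cite: Huxley1972, Ch. 27, (27.13)] -/
theorem lvIntegrand_eq (s : ℂ) (N : ℕ) {w : ℂ} (hw : w ≠ 1 - s) :
    lvIntegrand s N w = Complex.Gamma w * (((N : ℝ) / 2 : ℝ) : ℂ) ^ w * riemannZeta (s + w) := by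
  have hsw : s + w ≠ 1 := by intro h; apply hw; linear_combination h
  unfold lvIntegrand lvNum
  rw [LFunctions.riemannZeta₁_eq_mul hsw]
  have e : s + w - 1 = w - (1 - s) := by ring
  rw [e]; field_simp

/-- The numerator at `w = 1 − s`: `h(1−s) = Γ(1−s) (N/2)^{1−s}` (the residue of the integrand). [cite: Huxley1972, Ch. 27, (27.14)] -/
theorem lvNum_one_sub (s : ℂ) (N : ℕ) :
    lvNum s N (1 - s) = Complex.Gamma (1 - s) * (((N : ℝ) / 2 : ℝ) : ℂ) ^ (1 - s) := by
  unfold lvNum; rw [add_sub_cancel, riemannZeta₁_one, mul_one]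

/-- `h` is holomorphic on `re w > 0`. [folklore] -/
theorem differentiableOn_lvNum (s : ℂ) {N : ℕ} (hN : 1 ≤ N) :
    DifferentiableOn ℂ (lvNum s N) {w : ℂ | 0 < w.re} := by
  intro w hw
  have hw : 0 < w.re := hw
  refine DifferentiableAt.differentiableWithinAt ?_
  unfold lvNum
  refine DifferentiableAt.mul (DifferentiableAt.mul ?_ ?_) ?_
  · refine Complex.differentiableAt_Gamma _ fun m h ↦ ?_
    have := congrArg Complex.re h; simp at this
    have hm : (0 : ℝ) ≤ m := m.cast_nonneg; linarith
  · exact differentiableAt_id.const_cpow (Or.inl (ofReal_ne_zero.2 (by positivity)))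
  · exact (differentiable_riemannZeta₁.comp ((differentiable_const s).add differentiable_id)) w

/-- The integrand is holomorphic on `re w > 0` away from `w = 1 − s`. [folklore] -/
theorem differentiableOn_lvIntegrand (s : ℂ) {N : ℕ} (hN : 1 ≤ N) :
    DifferentiableOn ℂ (lvIntegrand s N) ({w : ℂ | 0 < w.re} \ {1 - s}) := by
  intro w hw
  have h1 : w - (1 - s) ≠ 0 := sub_ne_zero.2 fun h ↦ hw.2 h
  refine DifferentiableAt.differentiableWithinAt ?_
  unfold lvIntegrand
  refine DifferentiableAt.div ?_ (differentiableAt_id.sub_const _) h1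
  have hopen : IsOpen {w : ℂ | 0 < w.re} := isOpen_lt continuous_const Complex.continuous_re
  exact (differentiableOn_lvNum s hN).differentiableAt (hopen.mem_nhds hw.1)

/-- Continuity of the integrand along a vertical line `re w = c > 0`, `c ≠ 1 − re s`. [folklore] -/
theorem continuous_lvIntegrand_line (s : ℂ) {N : ℕ} (hN : 1 ≤ N) {c : ℝ} (hc : 0 < c)
    (hc1 : c ≠ 1 - s.re) : Continuous fun y : ℝ ↦ lvIntegrand s N (c + y * I) := by
  have hd := differentiableOn_lvIntegrand s hN
  have hline : Continuous fun y : ℝ ↦ (c : ℂ) + y * I := by fun_prop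
  refine hd.continuousOn.comp_continuous hline fun y ↦ ⟨by simp [hc], fun h ↦ hc1 ?_⟩
  have := congrArg Complex.re (show (c : ℂ) + y * I = 1 - s from h)
  simpa using this

/-- `Γ ≤ 1` on `[1, 2]`. [folklore] -/
private theorem real_Gamma_le_one_of_mem {x : ℝ} (h1 : 1 ≤ x) (h2 : x ≤ 2) : Real.Gamma x ≤ 1 := by
  have hmem : x ∈ segment ℝ (1 : ℝ) 2 := by rw [segment_eq_Icc (by norm_num)]; exact ⟨h1, h2⟩
  have := Real.convexOn_Gamma.le_max_of_mem_segment (by norm_num : (1 : ℝ) ∈ Set.Ioi 0)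
    (by norm_num : (2 : ℝ) ∈ Set.Ioi 0) hmem
  rw [Real.Gamma_one, Real.Gamma_two, max_self] at this
  exact this

/-- `e^{-π|y|/2} ≥ 1/6` for `|y| < 1`. [folklore] -/
theorem one_sixth_le_exp {y : ℝ} (hy : |y| < 1) : (1 : ℝ) / 6 ≤ Real.exp (-(π * |y| / 2)) := by
  have hπ : π * |y| / 2 ≤ 8 * (1 / 5) := by nlinarith [Real.pi_lt_d2, abs_nonneg y]
  have h02 : Real.exp (1 / 5 : ℝ) ≤ 5 / 4 := by
    have := Real.exp_bound_div_one_sub_of_interval' (x := (1 / 5 : ℝ)) (by norm_num) (by norm_num)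
    norm_num at this ⊢; exact this.le
  have h16 : Real.exp (8 * (1 / 5) : ℝ) ≤ 6 := by
    rw [show (8 * (1 / 5) : ℝ) = (8 : ℕ) * (1 / 5 : ℝ) by norm_num, Real.exp_nat_mul]
    calc Real.exp (1 / 5 : ℝ) ^ 8 ≤ (5 / 4 : ℝ) ^ 8 := pow_le_pow_left₀ (Real.exp_pos _).le h02 8
      _ ≤ 6 := by norm_num
  have h3 : Real.exp (-(8 * (1 / 5) : ℝ)) ≤ Real.exp (-(π * |y| / 2)) := Real.exp_le_exp.2 (by linarith)
  refine le_trans ?_ h3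
  rw [Real.exp_neg, le_inv_comm₀ (by norm_num) (Real.exp_pos _)]
  simpa using h16

/-- `Γ` on the line `re w = κ`, `0 < κ ≤ 1/4`: `‖Γ(κ+iy)‖ ≤ (12/κ)(1+|y|)² e^{-π|y|/2}` for all `y`.
[folklore] -/
theorem norm_Gamma_pos_line_le_exp {κ : ℝ} (hκ : 0 < κ) (hκ2 : κ ≤ 1 / 4) (y : ℝ) :
    ‖Complex.Gamma (κ + y * I)‖ ≤ 12 / κ * (1 + |y|) ^ 2 * Real.exp (-(π * |y| / 2)) := by
  have hκ' : 4 ≤ 1 / κ := by rw [le_div_iff₀ hκ]; linarith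
  rcases le_or_gt 1 |y| with hy | hy
  · have := norm_Gamma_vertical_le (x := κ) (by linarith) (by linarith) hy
    refine this.trans ?_
    have h0 : 0 ≤ (1 + |y|) ^ 2 * Real.exp (-(π * |y| / 2)) := by positivity
    calc 3 * (1 + |y|) ^ 2 * Real.exp (-(π * |y| / 2)) = 3 * ((1 + |y|) ^ 2 * Real.exp (-(π * |y| / 2))) := by ring
      _ ≤ 12 / κ * ((1 + |y|) ^ 2 * Real.exp (-(π * |y| / 2))) := by
          refine mul_le_mul_of_nonneg_right ?_ h0
          rw [div_eq_mul_one_div]; nlinarith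
      _ = _ := by ring
  · set w : ℂ := κ + y * I with hw
    have hw0 : w ≠ 0 := by
      intro h; have := congrArg Complex.re h; simp [hw] at this; linarith
    have hnw : κ ≤ ‖w‖ := by
      have := abs_re_le_norm w; simp [hw, abs_of_pos hκ] at this; exact this
    have hG1 : ‖Complex.Gamma (w + 1)‖ ≤ 1 := by
      have e : w + 1 = ((κ + 1 : ℝ) : ℂ) + y * I := by rw [hw]; push_cast; ring
      rw [e]
      exact (Literature.Analysis.SpecialFunctions.GammaVert.norm_Gamma_le_Gamma_re (by linarith) y).trans
        (real_Gamma_le_one_of_mem (by linarith) (by linarith))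
    have key : Complex.Gamma w = Complex.Gamma (w + 1) / w := by
      rw [Complex.Gamma_add_one _ hw0]; field_simp
    rw [key, norm_div]
    have he := one_sixth_le_exp hy
    have h1y : (1 : ℝ) ≤ (1 + |y|) ^ 2 := by nlinarith [abs_nonneg y]
    calc ‖Complex.Gamma (w + 1)‖ / ‖w‖ ≤ 1 / κ := div_le_div₀ zero_le_one hG1 hκ hnw
      _ ≤ 12 / κ * 1 * (1 / 6) := by rw [div_eq_mul_one_div 12]; nlinarith
      _ ≤ 12 / κ * (1 + |y|) ^ 2 * Real.exp (-(π * |y| / 2)) := by gcongr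

/-- `Γ ≤ 3` on `[1/3, 1]`: `Γ(x) = Γ(x+1)/x ≤ 1/x ≤ 3`. [folklore] -/
theorem real_Gamma_le_three_of_mem {x : ℝ} (h1 : 1 / 3 ≤ x) (h2 : x ≤ 1) : Real.Gamma x ≤ 3 := by
  have hx : 0 < x := by linarith
  have e : Real.Gamma x = Real.Gamma (x + 1) / x := by
    rw [Real.Gamma_add_one hx.ne']; field_simp
  rw [e, div_le_iff₀ hx]
  have := real_Gamma_le_one_of_mem (x := x + 1) (by linarith) (by linarith)
  nlinarith

variable {s : ℂ} {N : ℕ}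

/-- **The residue (27.14) is bounded** when `|t| ≥ log N` ("Hence if `|t| > log N` the residue
(27.14) is bounded"): `‖Γ(1−s)(N/2)^{1−s}‖ ≤ 3·2¹⁶` for `0 ≤ σ ≤ 2/3`, `log N ≤ |t|`, `N ≥ 2`.
[cite: Huxley1972, Ch. 27, (27.14)–(27.16)] -/
theorem norm_residue_lv_le (hN : 2 ≤ N) (hσ0 : 0 ≤ s.re) (hσ1 : s.re ≤ 2 / 3) (ht : Real.log N ≤ |s.im|) :
    ‖Complex.Gamma (1 - s) * (((N : ℝ) / 2 : ℝ) : ℂ) ^ (1 - s)‖ ≤ 3 * 2 ^ 16 := by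
  have hN0 : (0 : ℝ) < N := by positivity
  have hN2 : (2 : ℝ) ≤ N := by exact_mod_cast hN
  rw [norm_mul, Complex.norm_cpow_eq_rpow_re_of_pos (by positivity)]
  simp only [sub_re, one_re]
  have hpow : ((N : ℝ) / 2) ^ (1 - s.re) ≤ (N : ℝ) ^ (1 - s.re) :=
    Real.rpow_le_rpow (by positivity) (by linarith) (by linarith)
  rcases le_or_gt 1 |s.im| with ht1 | ht1
  · -- `|t| ≥ 1`
    have hG : ‖Complex.Gamma (1 - s)‖ ≤ 3 * (1 + |s.im|) ^ 2 * Real.exp (-(π * |s.im| / 2)) := by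
      rw [one_sub_eq s]
      have := norm_Gamma_vertical_le (x := 1 - s.re) (y := -s.im) (by linarith) (by linarith) (by rwa [abs_neg])
      rwa [abs_neg] at this
    have hNpow : (N : ℝ) ^ (1 - s.re) ≤ Real.exp |s.im| := by
      calc (N : ℝ) ^ (1 - s.re) ≤ (N : ℝ) ^ (1 : ℝ) :=
            Real.rpow_le_rpow_of_exponent_le (by linarith) (by linarith)
        _ = N := Real.rpow_one _
        _ = Real.exp (Real.log N) := (Real.exp_log hN0).symm
        _ ≤ Real.exp |s.im| := Real.exp_le_exp.2 ht
    have hpe := poly_exp_le s.im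
    have hE : 0 < Real.exp (-|s.im|) := Real.exp_pos _
    have h2 : (1 + |s.im|) ^ 2 ≤ (1 + |s.im|) ^ 5 := pow_le_pow_right₀ (by linarith [abs_nonneg s.im]) (by norm_num)
    have key : (1 + |s.im|) ^ 2 * Real.exp (-(π * |s.im| / 2)) * Real.exp |s.im| ≤ 2 ^ 16 := by
      have : (1 + |s.im|) ^ 2 * Real.exp (-(π * |s.im| / 2)) ≤ 2 ^ 16 * Real.exp (-|s.im|) :=
        le_trans (mul_le_mul_of_nonneg_right h2 (Real.exp_pos _).le) hpe
      calc (1 + |s.im|) ^ 2 * Real.exp (-(π * |s.im| / 2)) * Real.exp |s.im|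
          ≤ 2 ^ 16 * Real.exp (-|s.im|) * Real.exp |s.im| := mul_le_mul_of_nonneg_right this (Real.exp_pos _).le
        _ = 2 ^ 16 := by rw [mul_assoc, ← Real.exp_add]; simp
    calc ‖Complex.Gamma (1 - s)‖ * ((N : ℝ) / 2) ^ (1 - s.re)
        ≤ (3 * (1 + |s.im|) ^ 2 * Real.exp (-(π * |s.im| / 2))) * Real.exp |s.im| :=
          mul_le_mul hG (hpow.trans hNpow) (by positivity) (by positivity)
      _ = 3 * ((1 + |s.im|) ^ 2 * Real.exp (-(π * |s.im| / 2)) * Real.exp |s.im|) := by ring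
      _ ≤ 3 * 2 ^ 16 := by gcongr
  · -- `|t| < 1`: then `N = 2`
    have hN2' : N = 2 := by
      have hlog : Real.log N < 1 := lt_of_le_of_lt ht ht1
      have : (N : ℝ) < Real.exp 1 := by
        rw [Real.log_lt_iff_lt_exp hN0] at hlog; exact hlog
      have h3 : (N : ℝ) < 3 := this.trans (by have := Real.exp_one_lt_d9; linarith)
      have : N < 3 := by exact_mod_cast h3
      omega
    subst hN2'
    have hG : ‖Complex.Gamma (1 - s)‖ ≤ 3 := by
      rw [one_sub_eq s]
      refine (Literature.Analysis.SpecialFunctions.GammaVert.norm_Gamma_le_Gamma_re (by linarith) _).trans ?_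
      exact real_Gamma_le_three_of_mem (by linarith) (by linarith)
    have h1 : ((2 : ℕ) / 2 : ℝ) ^ (1 - s.re) = 1 := by norm_num
    push_cast at h1 ⊢
    rw [h1, mul_one]
    linarith

end MellinLV

end HuxleyLV

end Literature.NumberTheory.LFunctions

end

noncomputable section

open Real Set Filter Topology Complex MeasureTheory Finset
open scoped ComplexConjugate InnerProductSpace

namespace Literature.NumberTheory.LFunctions

namespace HuxleyLV

open HuxleyZeroDetection MeasureTheory

section MellinLV2

variable {s : ℂ} {N : ℕ}

/-- On `re w = 2`: `F(2+iy) = Γ(2+iy)(N/2)^{2+iy} L(1', s+2+iy)`. [cite: Huxley1972, Ch. 27, (27.13)] -/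
theorem lvIntegrand_two (hσ : 0 ≤ s.re) (N : ℕ) (y : ℝ) :
    lvIntegrand s N (((2 : ℝ) : ℂ) + y * I) =
      Complex.Gamma (2 + y * I) * (((N : ℝ) / 2 : ℝ) : ℂ) ^ (2 + y * I) * LSeries one' (s + (2 + y * I)) := by
  rw [Complex.ofReal_ofNat]
  have hw : (2 : ℂ) + y * I ≠ 1 - s := by
    intro h; have := congrArg Complex.re h; simp at this; linarith
  rw [lvIntegrand_eq s N hw, ArithmeticFunction.LSeries_zeta_eq_riemannZeta (by simp; linarith)]

/-- On `re w = 2`: `‖Γ(w)(N/2)^w ζ(s+w)‖ ≤ 192 (N/2)² (1+|y|)^{-2}` (`re s ≥ 0`, `N ≥ 2`). [folklore] -/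
theorem norm_lvIntegrand_two_le (hσ : 0 ≤ s.re) (hN : 2 ≤ N) (y : ℝ) :
    ‖lvIntegrand s N (((2 : ℝ) : ℂ) + y * I)‖ ≤ 192 * ((N : ℝ) / 2) ^ (2 : ℝ) * (1 + |y|) ^ (-2 : ℝ) := by
  rw [Complex.ofReal_ofNat]
  have hw : (2 : ℂ) + y * I ≠ 1 - s := by
    intro h; have := congrArg Complex.re h; simp at this; linarith
  rw [lvIntegrand_eq s N hw]
  have hN1 : (1 : ℝ) ≤ (N : ℝ) / 2 := by
    have : (2 : ℝ) ≤ N := by exact_mod_cast hN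
    linarith
  have hZ : ‖riemannZeta (s + (2 + y * I))‖ ≤ 2 := norm_zeta_le_two (by simp; linarith)
  have hG : ‖Complex.Gamma (2 + y * I)‖ ≤ 96 * (1 + |y|) ^ (-2 : ℝ) := MellinBarnes.norm_Gamma_two_line_le y
  have hY : ‖((((N : ℝ) / 2 : ℝ) : ℂ)) ^ (2 + y * I)‖ = ((N : ℝ) / 2) ^ (2 : ℝ) := by
    rw [Complex.norm_cpow_eq_rpow_re_of_pos (by linarith)]; simp
  rw [norm_mul, norm_mul, hY]
  have h0 : 0 ≤ (1 + |y|) ^ (-2 : ℝ) := by positivity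
  calc ‖Complex.Gamma (2 + y * I)‖ * ((N : ℝ) / 2) ^ (2 : ℝ) * ‖riemannZeta (s + (2 + y * I))‖
      ≤ (96 * (1 + |y|) ^ (-2 : ℝ)) * ((N : ℝ) / 2) ^ (2 : ℝ) * 2 := by gcongr
    _ = _ := by ring

/-- Integrability of the integrand on the line `re w = 2`. [folklore] -/
theorem integrable_lvIntegrand_two (hσ : 0 ≤ s.re) (hN : 2 ≤ N) :
    Integrable fun y : ℝ ↦ lvIntegrand s N (((2 : ℝ) : ℂ) + y * I) := by
  have hc : Continuous fun y : ℝ ↦ lvIntegrand s N (((2 : ℝ) : ℂ) + y * I) :=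
    continuous_lvIntegrand_line s (by omega) (by norm_num) (by linarith)
  have hI : Integrable fun τ : ℝ ↦ (1 + |τ|) ^ (-(2 : ℝ)) := by
    simpa [Real.norm_eq_abs] using integrable_one_add_norm (E := ℝ) (μ := volume) (r := 2) (by simp)
  refine ((hI.const_mul (192 * ((N : ℝ) / 2) ^ (2 : ℝ))).mono' hc.aestronglyMeasurable
    (Eventually.of_forall fun y ↦ ?_))
  exact norm_lvIntegrand_two_le hσ hN y

/-- `3 + |t + y| ≤ (3 + |t|)(1 + |y|)`. [folklore] -/
theorem three_add_abs_add_le (t y : ℝ) : 3 + |t + y| ≤ (3 + |t|) * (1 + |y|) := by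
  have := abs_add_le t y; nlinarith [abs_nonneg t, abs_nonneg y]

/-- **On the line `re w = κ`** (`0 < κ ≤ 1/4`, `0 ≤ σ ≤ 2/3`):
`‖F(κ+iy)‖ ≤ (12/κ)(N/2)^κ · 800 (3+|t|)^{1/2}(1+log(3+|t|)) · (1+|y|)⁵ e^{-π|y|/2}`.
[cite: Huxley1972, Ch. 27, (27.19)–(27.20)] -/
theorem norm_lvIntegrand_kappa_le {κ : ℝ} (hκ : 0 < κ) (hκ2 : κ ≤ 1 / 4) (hσ0 : 0 ≤ s.re)
    (hσ1 : s.re ≤ 2 / 3) (hN : 2 ≤ N) (y : ℝ) :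
    ‖lvIntegrand s N ((κ : ℂ) + y * I)‖ ≤
      12 / κ * ((N : ℝ) / 2) ^ κ * (800 * (3 + |s.im|) ^ (1 / 2 : ℝ) * (1 + Real.log (3 + |s.im|))) *
        ((1 + |y|) ^ 5 * Real.exp (-(π * |y| / 2))) := by
  have hw : (κ : ℂ) + y * I ≠ 1 - s := by
    intro h; have := congrArg Complex.re h; simp at this; linarith
  rw [lvIntegrand_eq s N hw]
  have hN1 : (1 : ℝ) ≤ (N : ℝ) / 2 := by
    have : (2 : ℝ) ≤ N := by exact_mod_cast hN
    linarith
  have hre : (s + (κ + y * I)).re = s.re + κ := by simp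
  have him : (s + (κ + y * I)).im = s.im + y := by simp
  have hZ := norm_zeta_le_sqrt (s := s + (κ + y * I)) (by rw [hre]; linarith) (by rw [hre]; linarith)
  rw [him] at hZ
  have hG := norm_Gamma_pos_line_le_exp hκ hκ2 y
  have hY : ‖((((N : ℝ) / 2 : ℝ) : ℂ)) ^ ((κ : ℂ) + y * I)‖ = ((N : ℝ) / 2) ^ κ := by
    rw [Complex.norm_cpow_eq_rpow_re_of_pos (by linarith)]; simp
  -- simplify the `ζ`-majorant
  set L : ℝ := 1 + Real.log (3 + |s.im|) with hL
  have hL1 : 1 ≤ L := by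
    have := Real.log_nonneg (show (1 : ℝ) ≤ 3 + |s.im| by linarith [abs_nonneg s.im]); rw [hL]; linarith
  have h3t : 0 < 3 + |s.im| := by positivity
  have hy0 : 0 ≤ |y| := abs_nonneg y
  have hsq : (3 + |s.im + y|) ^ (1 / 2 : ℝ) ≤ (3 + |s.im|) ^ (1 / 2 : ℝ) * (1 + |y|) := by
    calc (3 + |s.im + y|) ^ (1 / 2 : ℝ) ≤ ((3 + |s.im|) * (1 + |y|)) ^ (1 / 2 : ℝ) :=
          Real.rpow_le_rpow (by positivity) (three_add_abs_add_le _ _) (by norm_num)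
      _ = (3 + |s.im|) ^ (1 / 2 : ℝ) * (1 + |y|) ^ (1 / 2 : ℝ) := Real.mul_rpow h3t.le (by positivity)
      _ ≤ (3 + |s.im|) ^ (1 / 2 : ℝ) * (1 + |y|) := by
          refine mul_le_mul_of_nonneg_left ?_ (by positivity)
          calc (1 + |y|) ^ (1 / 2 : ℝ) ≤ (1 + |y|) ^ (1 : ℝ) :=
                Real.rpow_le_rpow_of_exponent_le (by linarith) (by norm_num)
            _ = 1 + |y| := Real.rpow_one _
  have hlog : 1 + Real.log (3 + |s.im + y|) ≤ L * (1 + |y|) := by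
    have h1 : Real.log (3 + |s.im + y|) ≤ Real.log (3 + |s.im|) + Real.log (1 + |y|) := by
      rw [← Real.log_mul h3t.ne' (by positivity)]
      exact Real.log_le_log (by positivity) (three_add_abs_add_le _ _)
    have h2 : Real.log (1 + |y|) ≤ |y| := by
      have := Real.add_one_le_exp |y|
      rw [Real.log_le_iff_le_exp (by positivity)]; linarith
    rw [hL]; nlinarith [Real.log_nonneg (show (1 : ℝ) ≤ 3 + |s.im| by linarith [abs_nonneg s.im])]
  have hZ' : ‖riemannZeta (s + (κ + y * I))‖ ≤ 800 * (3 + |s.im|) ^ (1 / 2 : ℝ) * L * (1 + |y|) ^ 2 := by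
    refine hZ.trans ?_
    have h0 : 0 ≤ 1 + Real.log (3 + |s.im + y|) := by
      have := Real.log_nonneg (show (1 : ℝ) ≤ 3 + |s.im + y| by linarith [abs_nonneg (s.im + y)]); linarith
    calc 800 * (3 + |s.im + y|) ^ (1 / 2 : ℝ) * (1 + Real.log (3 + |s.im + y|))
        ≤ 800 * ((3 + |s.im|) ^ (1 / 2 : ℝ) * (1 + |y|)) * (L * (1 + |y|)) :=
          mul_le_mul (mul_le_mul_of_nonneg_left hsq (by norm_num)) hlog h0 (by positivity)
      _ = _ := by ring
  rw [norm_mul, norm_mul, hY]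
  have hE0 : 0 ≤ Real.exp (-(π * |y| / 2)) := (Real.exp_pos _).le
  have h45 : (1 + |y|) ^ 4 ≤ (1 + |y|) ^ 5 := pow_le_pow_right₀ (by linarith) (by norm_num)
  calc ‖Complex.Gamma (κ + y * I)‖ * ((N : ℝ) / 2) ^ κ * ‖riemannZeta (s + (κ + y * I))‖
      ≤ (12 / κ * (1 + |y|) ^ 2 * Real.exp (-(π * |y| / 2))) * ((N : ℝ) / 2) ^ κ *
          (800 * (3 + |s.im|) ^ (1 / 2 : ℝ) * L * (1 + |y|) ^ 2) := by gcongr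
    _ = 12 / κ * ((N : ℝ) / 2) ^ κ * (800 * (3 + |s.im|) ^ (1 / 2 : ℝ) * L) *
          ((1 + |y|) ^ 4 * Real.exp (-(π * |y| / 2))) := by ring
    _ ≤ _ := by rw [hL]; gcongr

/-- Integrability of the integrand on the line `re w = κ`, `0 < κ ≤ 1/4`. [folklore] -/
theorem integrable_lvIntegrand_kappa {κ : ℝ} (hκ : 0 < κ) (hκ2 : κ ≤ 1 / 4) (hσ0 : 0 ≤ s.re)
    (hσ1 : s.re ≤ 2 / 3) (hN : 2 ≤ N) : Integrable fun y : ℝ ↦ lvIntegrand s N ((κ : ℂ) + y * I) := by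
  have hc : Continuous fun y : ℝ ↦ lvIntegrand s N ((κ : ℂ) + y * I) :=
    continuous_lvIntegrand_line s (by omega) hκ (by linarith)
  refine ((integrable_poly_exp.const_mul (12 / κ * ((N : ℝ) / 2) ^ κ *
    (800 * (3 + |s.im|) ^ (1 / 2 : ℝ) * (1 + Real.log (3 + |s.im|))))).mono' hc.aestronglyMeasurable
    (Eventually.of_forall fun y ↦ ?_))
  exact norm_lvIntegrand_kappa_le hκ hκ2 hσ0 hσ1 hN y

/-- Uniform decay of `F(σ' + iY)` as `|Y| → ∞`, `σ' ∈ [κ, 2]`. [folklore] -/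
theorem lvIntegrand_horizontal_decay {κ : ℝ} (hκ : 0 < κ) (hκ2 : κ ≤ 1 / 4) (hσ0 : 0 ≤ s.re)
    (hσ1 : s.re ≤ 2 / 3) (hN : 2 ≤ N) (ε : ℝ) (hε : 0 < ε) :
    ∃ T₀ : ℝ, ∀ σ' ∈ Set.Icc κ 2, ∀ Y : ℝ, T₀ ≤ |Y| → ‖lvIntegrand s N (σ' + Y * I)‖ ≤ ε := by
  have hN1 : (1 : ℝ) ≤ (N : ℝ) / 2 := by
    have : (2 : ℝ) ≤ N := by exact_mod_cast hN
    linarith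
  set K : ℝ := 576 * ((N : ℝ) / 2) ^ (2 : ℝ) * (1 + |s.im|) ^ 3 * 2 ^ 16 with hK
  have hlim : Tendsto (fun Y : ℝ ↦ K * Real.exp (-Y)) atTop (nhds 0) := by
    simpa using Real.tendsto_exp_neg_atTop_nhds_zero.const_mul K
  obtain ⟨T₁, hT₁⟩ := Filter.eventually_atTop.1 (hlim.eventually (ge_mem_nhds hε))
  refine ⟨max T₁ (max 1 (|s.im| + 1)), fun σ' hσ' Y hY ↦ ?_⟩
  have hY1 : 1 ≤ |Y| := le_trans (le_trans (le_max_left _ _) (le_max_right _ _)) hY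
  have hYt : |s.im| + 1 ≤ |Y| := le_trans (le_trans (le_max_right _ _) (le_max_right _ _)) hY
  have hYT : T₁ ≤ |Y| := le_trans (le_max_left _ _) hY
  set w : ℂ := (σ' : ℂ) + Y * I with hw
  have hw1 : w ≠ 1 - s := by
    intro h; have := congrArg Complex.im h; simp [hw] at this
    have : |Y| = |s.im| := by rw [this, abs_neg]
    linarith
  rw [lvIntegrand_eq s N hw1]
  have hre : (s + w).re = s.re + σ' := by simp [hw]
  have him : (s + w).im = s.im + Y := by simp [hw]
  have hZ : ‖riemannZeta (s + w)‖ ≤ 192 * ((1 + |s.im|) ^ 3 * (1 + |Y|) ^ 3) := by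
    refine (norm_zeta_le_poly (by rw [hre]; linarith [hσ'.1]) (by rw [hre]; linarith [hσ'.2]) ?_).trans ?_
    · have := abs_im_le_norm (s + w - 1)
      simp only [sub_im, one_im, him, sub_zero] at this
      have h2 : 1 ≤ |s.im + Y| := by
        have := abs_sub_abs_le_abs_sub Y (-s.im)
        rw [abs_neg, sub_neg_eq_add, add_comm] at this; linarith
      linarith
    · rw [him]
      have := one_add_abs_add_le s.im Y
      have h0 : 0 ≤ 1 + |s.im + Y| := by positivity
      calc 192 * (1 + |s.im + Y|) ^ 3 ≤ 192 * ((1 + |s.im|) * (1 + |Y|)) ^ 3 := by gcongr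
        _ = _ := by ring
  have hG : ‖Complex.Gamma w‖ ≤ 3 * (1 + |Y|) ^ 2 * Real.exp (-(π * |Y| / 2)) := by
    have := norm_Gamma_vertical_le (x := σ') (by linarith [hσ'.1]) (by linarith [hσ'.2]) hY1
    simpa [hw] using this
  have hYw : ‖((((N : ℝ) / 2 : ℝ) : ℂ)) ^ w‖ ≤ ((N : ℝ) / 2) ^ (2 : ℝ) := by
    rw [Complex.norm_cpow_eq_rpow_re_of_pos (by linarith)]
    simp only [hw, add_re, ofReal_re, mul_re, I_re, mul_zero, ofReal_im, I_im, mul_one, sub_self, add_zero]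
    exact Real.rpow_le_rpow_of_exponent_le hN1 hσ'.2
  have hpe := poly_exp_le Y
  calc ‖Complex.Gamma w * ((((N : ℝ) / 2 : ℝ) : ℂ)) ^ w * riemannZeta (s + w)‖
      = ‖Complex.Gamma w‖ * ‖((((N : ℝ) / 2 : ℝ) : ℂ)) ^ w‖ * ‖riemannZeta (s + w)‖ := by
        rw [norm_mul, norm_mul]
    _ ≤ (3 * (1 + |Y|) ^ 2 * Real.exp (-(π * |Y| / 2))) * ((N : ℝ) / 2) ^ (2 : ℝ) *
          (192 * ((1 + |s.im|) ^ 3 * (1 + |Y|) ^ 3)) := by gcongr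
    _ = 576 * ((N : ℝ) / 2) ^ (2 : ℝ) * (1 + |s.im|) ^ 3 * ((1 + |Y|) ^ 5 * Real.exp (-(π * |Y| / 2))) := by ring
    _ ≤ 576 * ((N : ℝ) / 2) ^ (2 : ℝ) * (1 + |s.im|) ^ 3 * (2 ^ 16 * Real.exp (-|Y|)) := by gcongr
    _ = K * Real.exp (-|Y|) := by rw [hK]; ring
    _ ≤ ε := hT₁ _ hYT

/-- **The identity behind (27.13)–(27.14)**: for `N ≥ 2`, `0 ≤ σ ≤ 2/3`, `0 < κ ≤ 1/4`,
`2π S_N(s) − ∫ F(κ+iy) dy = 2π Γ(1−s)(N/2)^{1−s}` (Mellin's formula on `re w = 2` and the shift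
to `re w = κ` across the pole of `ζ(s+w)` at `w = 1 − s`). [cite: Huxley1972, Ch. 27, (27.13)–(27.14)] -/
theorem expSum_identity {κ : ℝ} (hκ : 0 < κ) (hκ2 : κ ≤ 1 / 4) (hσ0 : 0 ≤ s.re) (hσ1 : s.re ≤ 2 / 3)
    (hN : 2 ≤ N) :
    2 * π * expSum N s - ∫ y : ℝ, lvIntegrand s N ((κ : ℂ) + y * I) =
      2 * π * (Complex.Gamma (1 - s) * (((N : ℝ) / 2 : ℝ) : ℂ) ^ (1 - s)) := by
  have hN0 : (0 : ℝ) < (N : ℝ) / 2 := by positivity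
  have h2 : ∫ y : ℝ, lvIntegrand s N (((2 : ℝ) : ℂ) + y * I) = 2 * π * expSum N s := by
    rw [integral_congr_ae (Eventually.of_forall (lvIntegrand_two hσ0 N)), expSum]
    exact integral_Gamma_cpow_LSeries_two_of_bounded norm_one'_le hN0 (by linarith)
  have hshift := integral_vertical_sub_eq_of_pole (lvNum s N) (1 - s) (a := κ) (b := 2)
    (by simp; linarith) (by simp; linarith)
    ((differentiableOn_lvNum s (by omega)).mono fun z hz ↦ by
      have := hz.1.1; simp only [Set.mem_setOf_eq]; linarith)
    (integrable_lvIntegrand_kappa hκ hκ2 hσ0 hσ1 hN)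
    (integrable_lvIntegrand_two hσ0 hN)
    (fun ε hε ↦ lvIntegrand_horizontal_decay hκ hκ2 hσ0 hσ1 hN ε hε)
  rw [lvNum_one_sub] at hshift
  change (∫ y : ℝ, lvIntegrand s N (((2 : ℝ) : ℂ) + y * I)) -
      (∫ y : ℝ, lvIntegrand s N ((κ : ℂ) + y * I)) = _ at hshift
  rw [h2] at hshift
  exact hshift

/-- **Huxley (27.20): the scalar products are `≪ |t|^{1/2} log²`.** For `N ≥ 2`, `0 ≤ σ ≤ 2/3`
and `|t| ≥ log N`:
`‖∑_{m ≥ 1} e^{-2m/N} m^{-σ−it}‖ ≤ 2³² (1 + log N) (3+|t|)^{1/2} (1 + log(3+|t|))`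
(Huxley: "`≪ 1 + |t|^{1/2} log|t| log N + … ≪ |t|^{1/2} log² N|t|`"). [cite: Huxley1972, Ch. 27, (27.20)] -/
theorem norm_expSum_le (hN : 2 ≤ N) (hσ0 : 0 ≤ s.re) (hσ1 : s.re ≤ 2 / 3) (ht : Real.log N ≤ |s.im|) :
    ‖expSum N s‖ ≤ 2 ^ 32 * (1 + Real.log N) * (3 + |s.im|) ^ (1 / 2 : ℝ) * (1 + Real.log (3 + |s.im|)) := by
  have hN2 : (2 : ℝ) ≤ N := by exact_mod_cast hN
  have hN0 : (0 : ℝ) < N := by linarith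
  have hlogN : 0 < Real.log N := Real.log_pos (by linarith)
  set κ : ℝ := min (1 / Real.log N) (1 / 4) with hκ
  have hκ0 : 0 < κ := by rw [hκ]; positivity
  have hκ4 : κ ≤ 1 / 4 := min_le_right _ _
  have hκL : κ ≤ 1 / Real.log N := min_le_left _ _
  have hκinv : 1 / κ ≤ Real.log N + 4 := by
    rw [hκ]
    rcases le_total (1 / Real.log N) (1 / 4) with h | h
    · rw [min_eq_left h, one_div_one_div]; linarith
    · rw [min_eq_right h]; norm_num
      have : Real.log N ≤ 4 := by
        rw [div_le_div_iff₀ (by norm_num) hlogN] at h; linarith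
      linarith [hlogN]
  -- `(N/2)^κ ≤ N^κ ≤ e`
  have hNκ : ((N : ℝ) / 2) ^ κ ≤ 3 := by
    calc ((N : ℝ) / 2) ^ κ ≤ (N : ℝ) ^ κ := Real.rpow_le_rpow (by positivity) (by linarith) hκ0.le
      _ = Real.exp (Real.log N * κ) := by rw [Real.rpow_def_of_pos hN0]
      _ ≤ Real.exp 1 := by
          refine Real.exp_le_exp.2 ?_
          calc Real.log N * κ ≤ Real.log N * (1 / Real.log N) := mul_le_mul_of_nonneg_left hκL hlogN.le
            _ = 1 := by field_simp
      _ ≤ 3 := by have := Real.exp_one_lt_d9; linarith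
  have hid := expSum_identity hκ0 hκ4 hσ0 hσ1 hN
  have hRes := norm_residue_lv_le hN hσ0 hσ1 ht
  set A : ℝ := (3 + |s.im|) ^ (1 / 2 : ℝ) * (1 + Real.log (3 + |s.im|)) with hA
  have hA1 : 1 ≤ A := by
    have h1 : (1 : ℝ) ≤ (3 + |s.im|) ^ (1 / 2 : ℝ) := Real.one_le_rpow (by linarith [abs_nonneg s.im]) (by norm_num)
    have h2 : (1 : ℝ) ≤ 1 + Real.log (3 + |s.im|) := by
      have := Real.log_nonneg (show (1 : ℝ) ≤ 3 + |s.im| by linarith [abs_nonneg s.im]); linarith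
    rw [hA]; nlinarith
  -- the integral on `re w = κ`
  have hI : ‖∫ y : ℝ, lvIntegrand s N ((κ : ℂ) + y * I)‖ ≤ 12 / κ * 3 * (800 * A) * 2 ^ 17 := by
    have hint := integrable_lvIntegrand_kappa hκ0 hκ4 hσ0 hσ1 hN
    calc ‖∫ y : ℝ, lvIntegrand s N ((κ : ℂ) + y * I)‖ ≤ ∫ y : ℝ, ‖lvIntegrand s N ((κ : ℂ) + y * I)‖ :=
          norm_integral_le_integral_norm _
      _ ≤ ∫ y : ℝ, 12 / κ * ((N : ℝ) / 2) ^ κ * (800 * (3 + |s.im|) ^ (1 / 2 : ℝ) * (1 + Real.log (3 + |s.im|))) *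
            ((1 + |y|) ^ 5 * Real.exp (-(π * |y| / 2))) :=
          integral_mono hint.norm (integrable_poly_exp.const_mul _) (norm_lvIntegrand_kappa_le hκ0 hκ4 hσ0 hσ1 hN)
      _ = 12 / κ * ((N : ℝ) / 2) ^ κ * (800 * A) * ∫ y : ℝ, (1 + |y|) ^ 5 * Real.exp (-(π * |y| / 2)) := by
          rw [integral_const_mul, hA]; ring
      _ ≤ 12 / κ * 3 * (800 * A) * 2 ^ 17 := by
          have h0 : 0 ≤ ∫ y : ℝ, (1 + |y|) ^ 5 * Real.exp (-(π * |y| / 2)) :=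
            integral_nonneg fun y ↦ by positivity
          gcongr
          · exact integral_poly_exp_le
  -- combine: `2π S = 2π Res + ∫F`
  have hEq : 2 * (π : ℂ) * expSum N s =
      2 * π * (Complex.Gamma (1 - s) * (((N : ℝ) / 2 : ℝ) : ℂ) ^ (1 - s)) +
        ∫ y : ℝ, lvIntegrand s N ((κ : ℂ) + y * I) := by
    linear_combination hid
  have h2π : ‖(2 * π : ℂ)‖ = 2 * π := by
    rw [norm_mul, Complex.norm_real, Complex.norm_ofNat, Real.norm_of_nonneg Real.pi_pos.le]
  have hnS : ‖2 * (π : ℂ) * expSum N s‖ = 2 * π * ‖expSum N s‖ := by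
    rw [show 2 * (π : ℂ) * expSum N s = (2 * π : ℂ) * expSum N s by ring, norm_mul, h2π]
  have key : 2 * π * ‖expSum N s‖ ≤ 2 * π * (3 * 2 ^ 16) + 12 / κ * 3 * (800 * A) * 2 ^ 17 := by
    rw [← hnS, hEq]
    refine (norm_add_le _ _).trans (add_le_add ?_ hI)
    rw [show 2 * (π : ℂ) * (Complex.Gamma (1 - s) * (((N : ℝ) / 2 : ℝ) : ℂ) ^ (1 - s)) =
      (2 * π : ℂ) * (Complex.Gamma (1 - s) * (((N : ℝ) / 2 : ℝ) : ℂ) ^ (1 - s)) by ring, norm_mul, h2π]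
    exact mul_le_mul_of_nonneg_left hRes (by positivity)
  have hπ3 : 3 < π := Real.pi_gt_three
  -- divide by `2π > 6` and simplify
  have hS : ‖expSum N s‖ ≤ 3 * 2 ^ 16 + 12 / κ * (800 * A) * 2 ^ 16 := by
    have h1 : 12 / κ * 3 * (800 * A) * 2 ^ 17 = 6 * (12 / κ * (800 * A) * 2 ^ 16) := by ring
    rw [h1] at key
    have h0 : 0 ≤ 12 / κ * (800 * A) * 2 ^ 16 := by positivity
    nlinarith
  calc ‖expSum N s‖ ≤ 3 * 2 ^ 16 + 12 / κ * (800 * A) * 2 ^ 16 := hS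
    _ = 3 * 2 ^ 16 + 12 * (1 / κ) * 800 * 2 ^ 16 * A := by ring
    _ ≤ 3 * 2 ^ 16 * ((1 + Real.log N) * A) + 12 * (Real.log N + 4) * 800 * 2 ^ 16 * A := by
        have h1A : (1 : ℝ) ≤ (1 + Real.log N) * A := by nlinarith
        refine add_le_add (le_mul_of_one_le_right (by positivity) h1A) ?_
        have hA0 : 0 ≤ A := by linarith
        gcongr
    _ ≤ 2 ^ 32 * (1 + Real.log N) * A := by nlinarith [hlogN, hA1]
    _ = _ := by rw [hA]; ring

end MellinLV2

end HuxleyLV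

end Literature.NumberTheory.LFunctions

end

noncomputable section

open Real Set Filter Topology Complex MeasureTheory Finset
open scoped ComplexConjugate InnerProductSpace

namespace Literature.NumberTheory.LFunctions

namespace HuxleyLV

open HuxleyZeroDetection WithLp
open scoped ComplexConjugate InnerProductSpace

/-! ## §3. Montgomery's vectors (27.9)–(27.12) in `ℂ^{N²}` and their scalar products -/

section Vectors

/-- `u_m = conj(e^{m/N} a(m))` for `1 ≤ m ≤ N`, `0` beyond (Huxley (27.9); the conjugate because
Mathlib's inner product is conjugate-linear in the first variable), as a vector in `ℂ^{N²}`,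
index `i ↦ m = i + 1`. [cite: Huxley1972, Ch. 27, (27.9)] -/
def uVec (N : ℕ) (a : ℕ → ℂ) : EuclideanSpace ℂ (Fin (N ^ 2)) :=
  toLp 2 fun i ↦ if i.val + 1 ≤ N then conj ((Real.exp (((i.val + 1 : ℕ) : ℝ) / N) : ℂ) * a (i.val + 1)) else 0

/-- `f^{(s)}_m = e^{-m/N} m^{-s}` for `1 ≤ m ≤ N²` (Huxley (27.10), truncated at `N²`).
[cite: Huxley1972, Ch. 27, (27.10)] -/
def fVec (N : ℕ) (s : ℂ) : EuclideanSpace ℂ (Fin (N ^ 2)) :=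
  toLp 2 fun i ↦ (Real.exp (-(((i.val + 1 : ℕ) : ℝ) / N)) : ℂ) * ((i.val + 1 : ℕ) : ℂ) ^ (-s)

variable {N : ℕ}

/-- Reindexing `Fin n` by `m = i + 1 ∈ [1, n]`: `∑_{i : Fin n} g(i+1) = ∑_{m=1}^{n} g(m)` in any
additive commutative monoid (the same statement as the tree's `Literature.NumberTheory.LFunctions.BaezDuarteOnlyIf.sum_fin_eq_sum_Icc`
in `NymanBeurlingProofs.lean`, which is not imported here). [folklore] -/
theorem sum_fin_eq_sum_Icc {M : Type*} [AddCommMonoid M] (n : ℕ) (g : ℕ → M) :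
    ∑ i : Fin n, g (i.val + 1) = ∑ m ∈ Finset.Icc 1 n, g m := by
  rw [Fin.sum_univ_eq_sum_range (fun k ↦ g (k + 1)) n, Finset.range_eq_Ico]
  have := Finset.sum_Ico_add' g 0 n 1
  simp only [zero_add] at this
  rw [this, Finset.Ico_add_one_right_eq_Icc]

/-- **(27.8): `(u, f^{(s)}) = ∑_{m ≤ N} a(m) m^{-s}`** (for `N ≥ 1`). [cite: Huxley1972, Ch. 27, (27.8)] -/
theorem inner_uVec_fVec (hN : 1 ≤ N) (a : ℕ → ℂ) (s : ℂ) :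
    ⟪uVec N a, fVec N s⟫_ℂ = ∑ m ∈ Finset.Icc 1 N, a m * (m : ℂ) ^ (-s) := by
  rw [uVec, fVec, EuclideanSpace.inner_toLp_toLp, dotProduct]
  simp only [Pi.star_apply, RCLike.star_def]
  have hterm : ∀ i : Fin (N ^ 2),
      (Real.exp (-(((i.val + 1 : ℕ) : ℝ) / N)) : ℂ) * ((i.val + 1 : ℕ) : ℂ) ^ (-s) *
        conj (if i.val + 1 ≤ N then conj ((Real.exp (((i.val + 1 : ℕ) : ℝ) / N) : ℂ) * a (i.val + 1)) else 0) =
      (fun m : ℕ ↦ if m ≤ N then a m * (m : ℂ) ^ (-s) else 0) (i.val + 1) := by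
    intro i
    dsimp only
    split_ifs with h
    · rw [Complex.conj_conj]
      have he : (Real.exp (-(((i.val + 1 : ℕ) : ℝ) / N)) : ℂ) * (Real.exp (((i.val + 1 : ℕ) : ℝ) / N) : ℂ) = 1 := by
        rw [← Complex.ofReal_mul, ← Real.exp_add]; simp
      linear_combination (a (i.val + 1) * ((i.val + 1 : ℕ) : ℂ) ^ (-s)) * he
    · simp
  rw [Finset.sum_congr rfl fun i _ ↦ hterm i,
    sum_fin_eq_sum_Icc (N ^ 2) (fun m : ℕ ↦ if m ≤ N then a m * (m : ℂ) ^ (-s) else 0)]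
  have hNN : N ≤ N ^ 2 := by nlinarith
  rw [← Finset.sum_subset (Finset.Icc_subset_Icc_right hNN)]
  · refine Finset.sum_congr rfl fun m hm ↦ ?_
    rw [Finset.mem_Icc] at hm; rw [if_pos hm.2]
  · intro m hm hm'
    rw [Finset.mem_Icc] at hm hm'
    rw [if_neg (by omega)]

/-- **(27.11): `‖u‖² ≤ e² ∑ |a(m)|²`.** [cite: Huxley1972, Ch. 27, (27.11)] -/
theorem norm_sq_uVec_le (hN : 1 ≤ N) (a : ℕ → ℂ) :
    ‖uVec N a‖ ^ 2 ≤ Real.exp 2 * ∑ m ∈ Finset.Icc 1 N, ‖a m‖ ^ 2 := by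
  rw [EuclideanSpace.norm_sq_eq, uVec]
  have hN0 : (0 : ℝ) < N := by exact_mod_cast hN
  have hterm : ∀ i : Fin (N ^ 2),
      ‖(if i.val + 1 ≤ N then conj ((Real.exp (((i.val + 1 : ℕ) : ℝ) / N) : ℂ) * a (i.val + 1)) else 0)‖ ^ 2 ≤
        (fun m : ℕ ↦ if m ≤ N then Real.exp 2 * ‖a m‖ ^ 2 else 0) (i.val + 1) := by
    intro i
    dsimp only
    split_ifs with h
    · rw [Complex.norm_conj, norm_mul, Complex.norm_real, Real.norm_of_nonneg (Real.exp_pos _).le, mul_pow]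
      refine mul_le_mul_of_nonneg_right ?_ (sq_nonneg _)
      rw [← Real.exp_nat_mul]
      refine Real.exp_le_exp.2 ?_
      push_cast
      have : (((i.val + 1 : ℕ) : ℝ)) / N ≤ 1 := by
        rw [div_le_one hN0]; exact_mod_cast h
      push_cast at this ⊢
      linarith
    · simp
  refine (Finset.sum_le_sum fun i _ ↦ hterm i).trans ?_
  rw [sum_fin_eq_sum_Icc (N ^ 2) (fun m : ℕ ↦ if m ≤ N then Real.exp 2 * ‖a m‖ ^ 2 else 0), Finset.mul_sum]
  have hNN : N ≤ N ^ 2 := by nlinarith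
  rw [← Finset.sum_subset (Finset.Icc_subset_Icc_right hNN)]
  · refine le_of_eq (Finset.sum_congr rfl fun m hm ↦ ?_)
    rw [Finset.mem_Icc] at hm; rw [if_pos hm.2]
  · intro m hm hm'
    rw [Finset.mem_Icc] at hm hm'
    rw [if_neg (by omega)]

/-- `∑_{m=1}^{M} e^{-2m/N} ≤ N/2`. [folklore] -/
theorem sum_exp_le (hN : 1 ≤ N) (M : ℕ) :
    ∑ m ∈ Finset.Icc 1 M, Real.exp (-(2 * m / N)) ≤ (N : ℝ) / 2 := by
  have hN0 : (0 : ℝ) < N := by exact_mod_cast hN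
  set r : ℝ := Real.exp (-(2 / N)) with hr
  have hr0 : 0 ≤ r := (Real.exp_pos _).le
  have hr1 : r < 1 := by
    rw [hr, Real.exp_lt_one_iff]
    have : (0 : ℝ) < 2 / N := by positivity
    linarith
  have hterm : ∀ m ∈ Finset.Icc 1 M, Real.exp (-(2 * m / N)) = r * r ^ (m - 1) := by
    intro m hm
    rw [Finset.mem_Icc] at hm
    rw [← pow_succ', Nat.sub_add_cancel hm.1, hr, ← Real.exp_nat_mul]
    congr 1; ring
  rw [Finset.sum_congr rfl hterm, ← Finset.mul_sum]
  have hgeo : ∑ m ∈ Finset.Icc 1 M, r ^ (m - 1) ≤ (1 - r)⁻¹ := by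
    calc ∑ m ∈ Finset.Icc 1 M, r ^ (m - 1) = ∑ k ∈ Finset.range M, r ^ k := by
          rw [Finset.range_eq_Ico]
          have h := Finset.sum_Ico_add' (fun k ↦ r ^ (k - 1)) 0 M 1
          simp only [zero_add, Finset.Ico_add_one_right_eq_Icc, Nat.add_sub_cancel] at h
          exact h.symm
      _ ≤ ∑' k, r ^ k := (summable_geometric_of_lt_one hr0 hr1).sum_le_tsum _ (fun k _ ↦ by positivity)
      _ = (1 - r)⁻¹ := tsum_geometric_of_lt_one hr0 hr1
  -- `r/(1-r) = 1/(e^{2/N} - 1) ≤ N/2`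
  have hkey : r * (1 - r)⁻¹ ≤ (N : ℝ) / 2 := by
    have h1r : 0 < 1 - r := by linarith
    rw [← div_eq_mul_inv, div_le_div_iff₀ h1r (by norm_num)]
    -- `2r ≤ N(1-r)` iff `r (N+2) ≤ N` iff `e^{2/N} ≥ 1 + 2/N`
    have he : 1 + 2 / (N : ℝ) ≤ Real.exp (2 / N) := by
      have := Real.add_one_le_exp (2 / (N : ℝ)); linarith
    have hrr : r * Real.exp (2 / N) = 1 := by rw [hr, ← Real.exp_add]; simp
    have : r * (1 + 2 / N) ≤ 1 := by nlinarith
    have e2 : r * (1 + 2 / (N : ℝ)) * N = r * (N + 2) := by field_simp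
    nlinarith
  calc r * ∑ m ∈ Finset.Icc 1 M, r ^ (m - 1) ≤ r * (1 - r)⁻¹ := mul_le_mul_of_nonneg_left hgeo hr0
    _ ≤ _ := hkey

/-- **(27.12): `‖f^{(s)}‖² ≤ ∑ e^{-2m/N} ≤ N/2 ≤ N`** for `re s ≥ 0`, `N ≥ 1`. [cite: Huxley1972, Ch. 27, (27.12)] -/
theorem norm_sq_fVec_le (hN : 1 ≤ N) {s : ℂ} (hs : 0 ≤ s.re) : ‖fVec N s‖ ^ 2 ≤ N := by
  rw [EuclideanSpace.norm_sq_eq, fVec]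
  have hterm : ∀ i : Fin (N ^ 2),
      ‖(Real.exp (-(((i.val + 1 : ℕ) : ℝ) / N)) : ℂ) * ((i.val + 1 : ℕ) : ℂ) ^ (-s)‖ ^ 2 ≤
        (fun m : ℕ ↦ Real.exp (-(2 * m / N))) (i.val + 1) := by
    intro i
    dsimp only
    rw [norm_mul, Complex.norm_real, Real.norm_of_nonneg (Real.exp_pos _).le, mul_pow,
      Complex.norm_natCast_cpow_of_pos (Nat.succ_pos _), neg_re]
    have h1 : ((i.val + 1 : ℕ) : ℝ) ^ (-s.re) ≤ 1 :=
      Real.rpow_le_one_of_one_le_of_nonpos (by exact_mod_cast Nat.succ_le_of_lt (Nat.succ_pos _)) (by linarith)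
    have h0 : 0 ≤ ((i.val + 1 : ℕ) : ℝ) ^ (-s.re) := by positivity
    calc Real.exp (-(((i.val + 1 : ℕ) : ℝ) / N)) ^ 2 * (((i.val + 1 : ℕ) : ℝ) ^ (-s.re)) ^ 2
        ≤ Real.exp (-(((i.val + 1 : ℕ) : ℝ) / N)) ^ 2 * 1 := by
          refine mul_le_mul_of_nonneg_left ?_ (sq_nonneg _); nlinarith
      _ = Real.exp (-(2 * ((i.val + 1 : ℕ) : ℝ) / N)) := by
          rw [mul_one, ← Real.exp_nat_mul]; congr 1; push_cast; ring
  refine (Finset.sum_le_sum fun i _ ↦ hterm i).trans ?_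
  rw [sum_fin_eq_sum_Icc (N ^ 2) (fun m : ℕ ↦ Real.exp (-(2 * m / N)))]
  have := sum_exp_le hN (N ^ 2)
  have hN0 : (0 : ℝ) ≤ N := Nat.cast_nonneg N
  linarith

/-- `conj(m^{-s}) = m^{-conj s}` for natural `m`. [folklore] -/
theorem conj_natCast_cpow (m : ℕ) (s : ℂ) : conj ((m : ℂ) ^ (-s)) = (m : ℂ) ^ (-conj s) := by
  have harg : (m : ℂ).arg ≠ π := by
    rw [Complex.natCast_arg]; exact Real.pi_ne_zero.symm
  have := Complex.cpow_conj (m : ℂ) (-s) harg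
  rw [map_neg] at this
  rw [this, Complex.conj_natCast]

/-- **The scalar products (27.13), truncated**: `(f^{(s₁)}, f^{(s₂)}) = ∑_{m ≤ N²} e^{-2m/N} m^{-(conj s₁ + s₂)}`
("Writing `σ` for `σ_r + σ_q` and `t` for `t_q − t_r`, `(f^{(r)}, f^{(q)}) = ∑ e^{-2m/N} m^{-σ−it}`").
[cite: Huxley1972, Ch. 27, (27.13)] -/
theorem inner_fVec_fVec (N : ℕ) (s₁ s₂ : ℂ) :
    ⟪fVec N s₁, fVec N s₂⟫_ℂ =
      ∑ m ∈ Finset.Icc 1 (N ^ 2), (Real.exp (-(2 * m / N)) : ℂ) * (m : ℂ) ^ (-(conj s₁ + s₂)) := by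
  rw [fVec, fVec, EuclideanSpace.inner_toLp_toLp, dotProduct]
  simp only [Pi.star_apply, RCLike.star_def]
  have hterm : ∀ i : Fin (N ^ 2),
      (Real.exp (-(((i.val + 1 : ℕ) : ℝ) / N)) : ℂ) * ((i.val + 1 : ℕ) : ℂ) ^ (-s₂) *
        conj ((Real.exp (-(((i.val + 1 : ℕ) : ℝ) / N)) : ℂ) * ((i.val + 1 : ℕ) : ℂ) ^ (-s₁)) =
      (fun m : ℕ ↦ (Real.exp (-(2 * m / N)) : ℂ) * (m : ℂ) ^ (-(conj s₁ + s₂))) (i.val + 1) := by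
    intro i
    dsimp only
    have hm0 : ((i.val + 1 : ℕ) : ℂ) ≠ 0 := Nat.cast_ne_zero.2 (Nat.succ_ne_zero _)
    rw [map_mul, Complex.conj_ofReal, conj_natCast_cpow, neg_add, Complex.cpow_add _ _ hm0]
    have he : (Real.exp (-(((i.val + 1 : ℕ) : ℝ) / N)) : ℂ) * (Real.exp (-(((i.val + 1 : ℕ) : ℝ) / N)) : ℂ) =
        (Real.exp (-(2 * ((i.val + 1 : ℕ) : ℝ) / N)) : ℂ) := by
      rw [← Complex.ofReal_mul, ← Real.exp_add]; congr 1; push_cast; congr 1; ring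
    rw [← he]; ring
  rw [Finset.sum_congr rfl fun i _ ↦ hterm i,
    sum_fin_eq_sum_Icc (N ^ 2) (fun m : ℕ ↦ (Real.exp (-(2 * m / N)) : ℂ) * (m : ℂ) ^ (-(conj s₁ + s₂)))]

/-- The truncated sum is the smoothed `L`-series minus a tail `≤ 1`:
`‖(f^{(s₁)}, f^{(s₂)}) − S_N(conj s₁ + s₂)‖ ≤ 1` for `re s₁, re s₂ ≥ 0`, `N ≥ 1`. [folklore] -/
theorem norm_inner_fVec_sub_expSum_le (hN : 1 ≤ N) {s₁ s₂ : ℂ} (h1 : 0 ≤ s₁.re) (h2 : 0 ≤ s₂.re) :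
    ‖⟪fVec N s₁, fVec N s₂⟫_ℂ - expSum N (conj s₁ + s₂)‖ ≤ 1 := by
  set w : ℂ := conj s₁ + s₂ with hw
  have hwre : 0 ≤ w.re := by simp [hw]; linarith
  have hN0 : (0 : ℝ) < N := by exact_mod_cast hN
  have hY : (0 : ℝ) < (N : ℝ) / 2 := by positivity
  -- the terms of `expSum`
  set tm : ℕ → ℂ := LSeries.term (smoothed one' ((N : ℝ) / 2)) w with htm
  have htm_eq : ∀ m : ℕ, m ≠ 0 → tm m = (Real.exp (-(2 * m / N)) : ℂ) * (m : ℂ) ^ (-w) := by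
    intro m hm
    rw [htm, LSeries.term_of_ne_zero hm, smoothed, one'_of_ne_zero hm, one_mul, cpow_neg, div_eq_mul_inv]
    congr 2; field_simp
  have htm_norm : ∀ m : ℕ, ‖tm m‖ ≤ Real.exp (-(2 / N)) ^ m := by
    intro m
    rcases eq_or_ne m 0 with rfl | hm
    · simp [htm, LSeries.term_zero]
    · rw [htm_eq m hm, norm_mul, Complex.norm_real, Real.norm_of_nonneg (Real.exp_pos _).le,
        Complex.norm_natCast_cpow_of_pos (Nat.pos_of_ne_zero hm), neg_re, ← Real.exp_nat_mul]
      have h1 : (m : ℝ) ^ (-w.re) ≤ 1 :=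
        Real.rpow_le_one_of_one_le_of_nonpos (by exact_mod_cast Nat.one_le_iff_ne_zero.2 hm) (by linarith)
      calc Real.exp (-(2 * m / N)) * (m : ℝ) ^ (-w.re) ≤ Real.exp (-(2 * m / N)) * 1 :=
            mul_le_mul_of_nonneg_left h1 (Real.exp_pos _).le
        _ = Real.exp (m * -(2 / N)) := by rw [mul_one]; congr 1; ring
  set r : ℝ := Real.exp (-(2 / N)) with hr
  have hr0 : 0 ≤ r := (Real.exp_pos _).le
  have hr1 : r < 1 := by
    rw [hr, Real.exp_lt_one_iff]
    have : (0 : ℝ) < 2 / N := by positivity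
    linarith
  have hsum : Summable tm := Summable.of_norm (Summable.of_nonneg_of_le (fun _ ↦ norm_nonneg _) htm_norm
    (summable_geometric_of_lt_one hr0 hr1))
  -- split the series at `N² + 1`
  have hsplit := (Summable.sum_add_tsum_nat_add (N ^ 2 + 1) hsum)
  have hfin : ∑ m ∈ Finset.range (N ^ 2 + 1), tm m = ⟪fVec N s₁, fVec N s₂⟫_ℂ := by
    rw [inner_fVec_fVec, Finset.range_eq_Ico, Finset.sum_eq_sum_Ico_succ_bot (by positivity), htm,
      LSeries.term_zero, zero_add]
    have : Finset.Ico 1 (N ^ 2 + 1) = Finset.Icc 1 (N ^ 2) := by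
      ext m; simp only [Finset.mem_Ico, Finset.mem_Icc]; omega
    rw [this]
    refine Finset.sum_congr rfl fun m hm ↦ ?_
    rw [Finset.mem_Icc] at hm
    exact htm_eq m (by omega)
  have hexp : expSum N w = ∑' m, tm m := rfl
  rw [hexp, ← hsplit, hfin, sub_add_cancel_left, norm_neg]
  -- the tail
  have hsumN : Summable fun m ↦ ‖tm (m + (N ^ 2 + 1))‖ :=
    (summable_nat_add_iff (f := fun m ↦ ‖tm m‖) (N ^ 2 + 1)).2 hsum.norm
  have hgeo : Summable fun m : ℕ ↦ r ^ (N ^ 2 + 1) * r ^ m := (summable_geometric_of_lt_one hr0 hr1).mul_left _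
  calc ‖∑' m, tm (m + (N ^ 2 + 1))‖ ≤ ∑' m, ‖tm (m + (N ^ 2 + 1))‖ := norm_tsum_le_tsum_norm hsumN
    _ ≤ ∑' m : ℕ, r ^ (N ^ 2 + 1) * r ^ m := by
        refine Summable.tsum_le_tsum (fun m ↦ ?_) hsumN hgeo
        calc ‖tm (m + (N ^ 2 + 1))‖ ≤ r ^ (m + (N ^ 2 + 1)) := htm_norm _
          _ = r ^ (N ^ 2 + 1) * r ^ m := by rw [pow_add]; ring
    _ = r ^ (N ^ 2 + 1) * (1 - r)⁻¹ := by rw [tsum_mul_left, tsum_geometric_of_lt_one hr0 hr1]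
    _ ≤ 1 := by
        -- `r^{N²+1}/(1-r) ≤ (N/2) r^{N²} ≤ (N/2) e^{-2N} ≤ 1`
        have h1r : 0 < 1 - r := by linarith
        have hrN : r * (1 - r)⁻¹ ≤ (N : ℝ) / 2 := by
          have := sum_exp_le hN 1
          simp at this
          have e : Real.exp (-(2 / (N : ℝ))) = r := rfl
          -- direct proof as in `sum_exp_le`
          rw [← div_eq_mul_inv, div_le_div_iff₀ h1r (by norm_num)]
          have he : 1 + 2 / (N : ℝ) ≤ Real.exp (2 / N) := by
            have := Real.add_one_le_exp (2 / (N : ℝ)); linarith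
          have hrr : r * Real.exp (2 / N) = 1 := by rw [hr, ← Real.exp_add]; simp
          have : r * (1 + 2 / N) ≤ 1 := by nlinarith
          have e2 : r * (1 + 2 / (N : ℝ)) * N = r * (N + 2) := by field_simp
          nlinarith
        have hrpow : r ^ (N ^ 2) ≤ Real.exp (-(2 * N)) := by
          rw [hr, ← Real.exp_nat_mul]
          refine Real.exp_le_exp.2 (le_of_eq ?_)
          push_cast
          field_simp
        have hNexp : (N : ℝ) / 2 * Real.exp (-(2 * N)) ≤ 1 := by
          -- `N e^{-2N} ≤ 1/2 · ... `: use `x ≤ e^x` with `x = 2N`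
          have := Real.add_one_le_exp (2 * (N : ℝ))
          have hE : Real.exp (-(2 * (N : ℝ))) * Real.exp (2 * N) = 1 := by rw [← Real.exp_add]; simp
          have hE0 : 0 < Real.exp (2 * (N : ℝ)) := Real.exp_pos _
          nlinarith [Real.exp_pos (-(2 * (N : ℝ)))]
        calc r ^ (N ^ 2 + 1) * (1 - r)⁻¹ = r ^ (N ^ 2) * (r * (1 - r)⁻¹) := by rw [pow_succ]; ring
          _ ≤ Real.exp (-(2 * N)) * ((N : ℝ) / 2) :=
              mul_le_mul hrpow hrN (by positivity) (Real.exp_pos _).le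
          _ ≤ 1 := by rw [mul_comm]; exact hNexp

/-- **(27.20) for the truncated scalar products**: for `N ≥ 2`, `re s₁, re s₂ ∈ [0, 1/3]`,
`log N ≤ |t₂ − t₁|`:
`‖(f^{(s₁)}, f^{(s₂)})‖ ≤ 2³³ (1 + log N) (3+|t₂−t₁|)^{1/2} (1 + log(3+|t₂−t₁|))`. [cite: Huxley1972, Ch. 27, (27.20)] -/
theorem norm_inner_fVec_le (hN : 2 ≤ N) {s₁ s₂ : ℂ} (h1 : 0 ≤ s₁.re) (h1' : s₁.re ≤ 1 / 3)
    (h2 : 0 ≤ s₂.re) (h2' : s₂.re ≤ 1 / 3) (ht : Real.log N ≤ |s₂.im - s₁.im|) :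
    ‖⟪fVec N s₁, fVec N s₂⟫_ℂ‖ ≤
      2 ^ 33 * (1 + Real.log N) * (3 + |s₂.im - s₁.im|) ^ (1 / 2 : ℝ) * (1 + Real.log (3 + |s₂.im - s₁.im|)) := by
  set w : ℂ := conj s₁ + s₂ with hw
  have hwre : w.re = s₁.re + s₂.re := by simp [hw]
  have hwim : w.im = s₂.im - s₁.im := by simp [hw]; ring
  have hS := norm_expSum_le (s := w) hN (by rw [hwre]; linarith) (by rw [hwre]; linarith) (by rwa [hwim])
  rw [hwim] at hS
  have hdiff := norm_inner_fVec_sub_expSum_le (by omega) h1 h2 (s₁ := s₁) (s₂ := s₂) (N := N)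
  have hA : (1 : ℝ) ≤ (1 + Real.log N) * (3 + |s₂.im - s₁.im|) ^ (1 / 2 : ℝ) * (1 + Real.log (3 + |s₂.im - s₁.im|)) := by
    have hl : (1 : ℝ) ≤ 1 + Real.log N := by
      have := Real.log_nonneg (show (1 : ℝ) ≤ N by exact_mod_cast (by omega : 1 ≤ N)); linarith
    have h3 : (1 : ℝ) ≤ (3 + |s₂.im - s₁.im|) ^ (1 / 2 : ℝ) :=
      Real.one_le_rpow (by linarith [abs_nonneg (s₂.im - s₁.im)]) (by norm_num)
    have hL : (1 : ℝ) ≤ 1 + Real.log (3 + |s₂.im - s₁.im|) := by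
      have := Real.log_nonneg (show (1 : ℝ) ≤ 3 + |s₂.im - s₁.im| by linarith [abs_nonneg (s₂.im - s₁.im)])
      linarith
    calc (1 : ℝ) = 1 * 1 * 1 := by ring
      _ ≤ _ := mul_le_mul (mul_le_mul hl h3 (by norm_num) (by linarith)) hL (by norm_num) (by positivity)
  calc ‖⟪fVec N s₁, fVec N s₂⟫_ℂ‖ = ‖(⟪fVec N s₁, fVec N s₂⟫_ℂ - expSum N w) + expSum N w‖ := by ring_nf
    _ ≤ ‖⟪fVec N s₁, fVec N s₂⟫_ℂ - expSum N w‖ + ‖expSum N w‖ := norm_add_le _ _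
    _ ≤ 1 + 2 ^ 32 * (1 + Real.log N) * (3 + |s₂.im - s₁.im|) ^ (1 / 2 : ℝ) * (1 + Real.log (3 + |s₂.im - s₁.im|)) :=
        add_le_add hdiff hS
    _ ≤ _ := by nlinarith

end Vectors

end HuxleyLV

end Literature.NumberTheory.LFunctions

end

noncomputable section

open Real Set Filter Topology Complex MeasureTheory Finset
open scoped ComplexConjugate InnerProductSpace

namespace Literature.NumberTheory.LFunctions

namespace HuxleyLV

open HuxleyZeroDetection Finset
open scoped ComplexConjugate InnerProductSpace

/-! ## §4. Halász's lemma on windows of length `T₀`, and the theorem (27.21)–(27.27) -/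

section Final

variable {N : ℕ} {a : ℕ → ℂ} {V : ℝ}

/-- **One window** (Huxley (27.5)–(27.8) with (27.11)–(27.12)): if the points of `S_k` have
`0 ≤ σ ≤ 1/3`, `|∑ a(m) m^{-s}| ≥ V`, pairwise scalar products `≤ B`, and the proviso
`2 e² G B ≤ V²` holds, then `#S_k ≤ 2 V⁻² e² G N`. [cite: Huxley1972, Ch. 27, (27.6)–(27.12)] -/
theorem card_window_le (hN : 2 ≤ N) (hV : 0 < V) {B : ℝ} (hB0 : 0 ≤ B) (Sk : Finset ℂ)
    (hre : ∀ s ∈ Sk, 0 ≤ s.re ∧ s.re ≤ 1 / 3)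
    (hlarge : ∀ s ∈ Sk, V ≤ ‖∑ m ∈ Finset.Icc 1 N, a m * (m : ℂ) ^ (-s)‖)
    (hB : ∀ r ∈ Sk, ∀ q ∈ Sk, r ≠ q → ‖⟪fVec N r, fVec N q⟫_ℂ‖ ≤ B)
    (hprov : 2 * (Real.exp 2 * ∑ m ∈ Finset.Icc 1 N, ‖a m‖ ^ 2) * B ≤ V ^ 2) :
    (#Sk : ℝ) ≤ 2 * V⁻¹ ^ 2 * (Real.exp 2 * ∑ m ∈ Finset.Icc 1 N, ‖a m‖ ^ 2) * N := by
  have hN1 : 1 ≤ N := by omega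
  have hu := norm_sq_uVec_le hN1 a
  have h := halasz_lemma (E := EuclideanSpace ℂ (Fin (N ^ 2))) Sk (uVec N a) (fVec N) (V := V)
    (M := (N : ℝ)) (B := B) hV (Nat.cast_nonneg N)
    (fun r hr ↦ by rw [inner_uVec_fVec hN1]; exact hlarge r hr)
    (fun r hr ↦ norm_sq_fVec_le hN1 (hre r hr).1) hB
    (le_trans (by nlinarith [norm_nonneg (uVec N a)]) hprov)
  refine h.trans ?_
  have hV2 : 0 ≤ 2 * V⁻¹ ^ 2 := by positivity
  have hN0 : (0 : ℝ) ≤ N := Nat.cast_nonneg N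
  calc 2 * V⁻¹ ^ 2 * ‖uVec N a‖ ^ 2 * N = 2 * V⁻¹ ^ 2 * (‖uVec N a‖ ^ 2 * N) := by ring
    _ ≤ 2 * V⁻¹ ^ 2 * ((Real.exp 2 * ∑ m ∈ Finset.Icc 1 N, ‖a m‖ ^ 2) * N) :=
        mul_le_mul_of_nonneg_left (mul_le_mul_of_nonneg_right hu hN0) hV2
    _ = _ := by ring

/-- Two nonnegative reals in the same window of length `ℓ` differ by less than `ℓ`. [folklore] -/
theorem abs_sub_lt_of_floor_eq {x y ℓ : ℝ} (hℓ : 0 < ℓ) (hx : 0 ≤ x) (hy : 0 ≤ y)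
    (h : ⌊x / ℓ⌋₊ = ⌊y / ℓ⌋₊) : |x - y| < ℓ := by
  have hx1 := Nat.floor_le (div_nonneg hx hℓ.le)
  have hx2 := Nat.lt_floor_add_one (x / ℓ)
  have hy1 := Nat.floor_le (div_nonneg hy hℓ.le)
  have hy2 := Nat.lt_floor_add_one (y / ℓ)
  rw [h] at hx1 hx2
  rw [le_div_iff₀ hℓ] at hx1 hy1
  rw [div_lt_iff₀ hℓ] at hx2 hy2
  rw [abs_lt]; constructor <;> nlinarith

/-- The logarithmic factors: `(1 + log N)(1 + log(3+T)) ≤ 9 log²(NT)` for `N ≥ 2`, `T ≥ 1`.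
[folklore] -/
theorem log_factor_le (hN : 2 ≤ N) {T : ℝ} (hT : 1 ≤ T) :
    (1 + Real.log N) * (1 + Real.log (3 + T)) ≤ 9 * Real.log (N * T) ^ 2 := by
  have hN2 : (2 : ℝ) ≤ N := by exact_mod_cast hN
  have hl2 := Real.log_two_gt_d9
  have hl2' := Real.log_two_lt_d9
  have hlogN : Real.log 2 ≤ Real.log N := Real.log_le_log (by norm_num) hN2
  have hlogT : 0 ≤ Real.log T := Real.log_nonneg hT
  have hL : Real.log (N * T) = Real.log N + Real.log T := Real.log_mul (by positivity) (by positivity)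
  have h4 : Real.log (3 + T) ≤ Real.log 4 + Real.log T := by
    rw [← Real.log_mul (by norm_num) (by positivity)]
    exact Real.log_le_log (by linarith) (by linarith)
  have hlog4 : Real.log 4 = 2 * Real.log 2 := by
    rw [show (4 : ℝ) = 2 ^ 2 by norm_num, Real.log_pow]; push_cast; ring
  have hA : 1 + Real.log N ≤ 2.45 * Real.log N := by nlinarith
  have hB : 1 + Real.log (3 + T) ≤ 3.47 * (Real.log N + Real.log T) := by nlinarith
  have hA0 : 0 ≤ 1 + Real.log N := by linarith
  rw [hL]
  calc (1 + Real.log N) * (1 + Real.log (3 + T)) ≤ (2.45 * Real.log N) * (3.47 * (Real.log N + Real.log T)) :=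
        mul_le_mul hA hB (by have := Real.log_nonneg (show (1:ℝ) ≤ 3 + T by linarith); linarith) (by linarith)
    _ ≤ 9 * (Real.log N + Real.log T) ^ 2 := by nlinarith

/-- `e² ≤ 8`, `e⁶ ≤ 512`. [folklore] -/
private theorem exp_two_le : Real.exp 2 ≤ 8 := by
  have := Real.exp_one_lt_d9
  rw [show (2 : ℝ) = 1 + 1 by norm_num, Real.exp_add]; nlinarith [Real.exp_pos 1]

/-- Bookkeeping, long windows: `(2T/(X²/2)) · 2V⁻²e²GN = 32 e⁶ K₁² G³NTV⁻⁶ ≤ 2⁹⁰ G³NTV⁻⁶L⁴`.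
[folklore] -/
theorem lv_caseA {G K₁ V T Nr L X : ℝ} (hG : 0 < G) (hK₁ : 0 < K₁) (hV : 0 < V) (hT : 0 ≤ T)
    (hN : 0 ≤ Nr) (hX : X = V ^ 2 / (2 * Real.exp 2 * G * K₁))
    (hK₁L : K₁ ^ 2 ≤ 2 ^ 66 * 81 * L ^ 4) :
    2 * T / (X ^ 2 / 2) * (2 * V⁻¹ ^ 2 * (Real.exp 2 * G) * Nr) ≤ 2 ^ 90 * (G ^ 3 * Nr * T * V⁻¹ ^ 6 * L ^ 4) := by
  have he0 : 0 < Real.exp 2 := Real.exp_pos 2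
  have he3 : Real.exp 2 ^ 3 ≤ 512 := by
    calc Real.exp 2 ^ 3 ≤ 8 ^ 3 := pow_le_pow_left₀ he0.le exp_two_le 3
      _ = 512 := by norm_num
  have hXpos : 0 < X := by rw [hX]; positivity
  have hXinv : (X ^ 2)⁻¹ = (2 * Real.exp 2 * G * K₁) ^ 2 * (V ^ 2)⁻¹ ^ 2 := by
    rw [hX]; field_simp
  have e1 : 2 * T / (X ^ 2 / 2) * (2 * V⁻¹ ^ 2 * (Real.exp 2 * G) * Nr) =
      8 * T * (X ^ 2)⁻¹ * (V⁻¹ ^ 2 * (Real.exp 2 * G) * Nr) := by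
    field_simp; ring
  rw [e1, hXinv]
  have e2 : 8 * T * ((2 * Real.exp 2 * G * K₁) ^ 2 * (V ^ 2)⁻¹ ^ 2) * (V⁻¹ ^ 2 * (Real.exp 2 * G) * Nr) =
      32 * Real.exp 2 ^ 3 * K₁ ^ 2 * (G ^ 3 * Nr * T * V⁻¹ ^ 6) := by
    rw [inv_pow, ← pow_mul]; ring
  rw [e2]
  have h0 : 0 ≤ G ^ 3 * Nr * T * V⁻¹ ^ 6 := by positivity
  calc 32 * Real.exp 2 ^ 3 * K₁ ^ 2 * (G ^ 3 * Nr * T * V⁻¹ ^ 6)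
      ≤ 32 * 512 * (2 ^ 66 * 81 * L ^ 4) * (G ^ 3 * Nr * T * V⁻¹ ^ 6) := by gcongr
    _ = (32 * 512 * 2 ^ 66 * 81) * (G ^ 3 * Nr * T * V⁻¹ ^ 6 * L ^ 4) := by ring
    _ ≤ 2 ^ 90 * (G ^ 3 * Nr * T * V⁻¹ ^ 6 * L ^ 4) :=
        mul_le_mul_of_nonneg_right (by norm_num) (by positivity)

/-- Bookkeeping, short windows (`X² < 6`): `(2T/(log N/2)) · 2V⁻²e²GN ≤ 2⁹⁰ G³NTV⁻⁶L⁴`. [folklore] -/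
theorem lv_caseB {G K₁ V T Nr L X lN : ℝ} (hG : 0 < G) (hK₁ : 0 < K₁) (hV : 0 < V) (hT : 0 ≤ T)
    (hN : 0 ≤ Nr) (hlN : Real.log 2 ≤ lN) (hX : X = V ^ 2 / (2 * Real.exp 2 * G * K₁))
    (hK₁L : K₁ ^ 2 ≤ 2 ^ 66 * 81 * L ^ 4) (hcase : X ^ 2 < 6) :
    2 * T / (lN / 2) * (2 * V⁻¹ ^ 2 * (Real.exp 2 * G) * Nr) ≤ 2 ^ 90 * (G ^ 3 * Nr * T * V⁻¹ ^ 6 * L ^ 4) := by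
  have he0 : 0 < Real.exp 2 := Real.exp_pos 2
  have he3 : Real.exp 2 ^ 3 ≤ 512 := by
    calc Real.exp 2 ^ 3 ≤ 8 ^ 3 := pow_le_pow_left₀ he0.le exp_two_le 3
      _ = 512 := by norm_num
  have hl2 := Real.log_two_gt_d9
  have hlN0 : 0 < lN := by linarith
  have hXdef : 2 * Real.exp 2 * G * K₁ * X = V ^ 2 := by rw [hX]; field_simp
  have hV4 : V ^ 2 * V ^ 2 ≤ 6 * (2 * Real.exp 2 * G * K₁) ^ 2 := by
    have : X ^ 2 * (2 * Real.exp 2 * G * K₁) ^ 2 = V ^ 2 * V ^ 2 := by rw [← hXdef]; ring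
    nlinarith [sq_nonneg (2 * Real.exp 2 * G * K₁)]
  have e1 : 2 * T / (lN / 2) * (2 * V⁻¹ ^ 2 * (Real.exp 2 * G) * Nr) =
      8 * Real.exp 2 * lN⁻¹ * (T * G * Nr * V⁻¹ ^ 2) := by field_simp; ring
  rw [e1]
  have h0 : 0 ≤ T * G * Nr * V⁻¹ ^ 6 := by positivity
  have hK2 : (2 * Real.exp 2 * G * K₁) ^ 2 = 4 * Real.exp 2 ^ 2 * G ^ 2 * K₁ ^ 2 := by ring
  have hinv : lN⁻¹ ≤ 2 := by rw [inv_le_comm₀ hlN0 (by norm_num)]; linarith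
  have hV0 : V ≠ 0 := hV.ne'
  calc 8 * Real.exp 2 * lN⁻¹ * (T * G * Nr * V⁻¹ ^ 2)
      = 8 * Real.exp 2 * lN⁻¹ * (V ^ 2 * V ^ 2) * (T * G * Nr * V⁻¹ ^ 6) := by field_simp
    _ ≤ 8 * Real.exp 2 * lN⁻¹ * (6 * (2 * Real.exp 2 * G * K₁) ^ 2) * (T * G * Nr * V⁻¹ ^ 6) := by gcongr
    _ = 192 * Real.exp 2 ^ 3 * lN⁻¹ * K₁ ^ 2 * (G ^ 3 * Nr * T * V⁻¹ ^ 6) := by rw [hK2]; ring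
    _ ≤ 192 * 512 * 2 * (2 ^ 66 * 81 * L ^ 4) * (G ^ 3 * Nr * T * V⁻¹ ^ 6) := by gcongr
    _ = (192 * 512 * 2 * 2 ^ 66 * 81) * (G ^ 3 * Nr * T * V⁻¹ ^ 6 * L ^ 4) := by ring
    _ ≤ 2 ^ 90 * (G ^ 3 * Nr * T * V⁻¹ ^ 6 * L ^ 4) :=
        mul_le_mul_of_nonneg_right (by norm_num) (by positivity)

/-- Bookkeeping, the sum over windows. [folklore] -/
theorem lv_combine {G V Nr A W second : ℝ} (hG : 0 ≤ G) (hN : 0 ≤ Nr) (hW : W = 2 * V⁻¹ ^ 2 * (Real.exp 2 * G) * Nr)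
    (h2 : second * W ≤ 2 ^ 90 * A) (hA : 0 ≤ A) :
    (second + 1) * W ≤ 2 ^ 91 * (G * Nr * V⁻¹ ^ 2 + A) := by
  have he2 := exp_two_le
  have hfirst : W ≤ 2 ^ 4 * (G * Nr * V⁻¹ ^ 2) := by
    rw [hW]
    have h0 : 0 ≤ G * Nr * V⁻¹ ^ 2 := by positivity
    nlinarith
  have h1 : 0 ≤ G * Nr * V⁻¹ ^ 2 := by positivity
  nlinarith

set_option maxHeartbeats 400000 in
/-- **Huxley's large-values theorem** (Ch. 27, THEOREM (27.24)–(27.27)) — discharge of the named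
fact `Literature.NumberTheory.LFunctions.Huxley1972_largeValues`: "`R ≪ GNV⁻² + G³NTV⁻⁶ log⁴ NT`, the implied constants being
absolute". Proof as printed (pp. 74–76): Halász's lemma with Montgomery's vectors (27.9)–(27.10),
the scalar-product bound (27.20) from Mellin's formula and `|ζ(λ+iτ)| ≪ |τ|^{1/2} log|τ|`, and
the subdivision of the `t`-range into windows of length `T₀` (27.21)–(27.23); when the proviso
(27.7) cannot be met even on windows shorter than the separation `log N`, the windows contain
single points and Halász's lemma applies with `B = 0`. The constant obtained is `2⁹¹`.
[cite: Huxley1972, Ch. 27, Theorem (27.24)–(27.27)] -/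
theorem largeValues_holds : Huxley1972_largeValues := by
  refine ⟨2 ^ 91, fun N a T V S hN hT hV hre hsep hlarge ↦ ?_⟩
  classical
  obtain ⟨G, hG⟩ : ∃ G : ℝ, G = ∑ m ∈ Finset.Icc 1 N, ‖a m‖ ^ 2 := ⟨_, rfl⟩
  have hG0 : 0 ≤ G := by rw [hG]; exact Finset.sum_nonneg fun _ _ ↦ sq_nonneg _
  have hN1 : 1 ≤ N := by omega
  have hN2 : (2 : ℝ) ≤ N := by exact_mod_cast hN
  have hN0 : (0 : ℝ) ≤ N := Nat.cast_nonneg N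
  obtain ⟨L, hL⟩ : ∃ L : ℝ, L = Real.log (N * T) := ⟨_, rfl⟩
  have hl2 := Real.log_two_gt_d9
  have hL0 : Real.log 2 ≤ L := by rw [hL]; exact Real.log_le_log (by norm_num) (by nlinarith)
  have hLpos : 0 < L := by linarith
  have hlogN : Real.log 2 ≤ Real.log N := Real.log_le_log (by norm_num) hN2
  have hlogN0 : 0 < Real.log N := by linarith
  rw [← hG, ← hL]
  have hRHS0 : 0 ≤ (2 : ℝ) ^ 91 * (G * N * V⁻¹ ^ 2 + G ^ 3 * N * T * V⁻¹ ^ 6 * L ^ 4) := by positivity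
  rcases S.eq_empty_or_nonempty with hSe | hne
  · rw [hSe, Finset.card_empty, Nat.cast_zero]; exact hRHS0
  obtain ⟨s₀, hs₀⟩ := hne
  -- `G > 0` (from `V² ≤ e² G N`)
  have hV2 : V ^ 2 ≤ Real.exp 2 * G * N := by
    have h1 := hlarge s₀ hs₀
    rw [← inner_uVec_fVec hN1] at h1
    have h2 := norm_inner_le_norm (𝕜 := ℂ) (uVec N a) (fVec N s₀)
    have h3 : V ^ 2 ≤ ‖uVec N a‖ ^ 2 * ‖fVec N s₀‖ ^ 2 := by
      rw [← mul_pow]; exact pow_le_pow_left₀ hV.le (h1.trans h2) 2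
    have h4 := norm_sq_uVec_le hN1 a
    rw [← hG] at h4
    have h5 := norm_sq_fVec_le hN1 (hre s₀ hs₀).1
    calc V ^ 2 ≤ ‖uVec N a‖ ^ 2 * ‖fVec N s₀‖ ^ 2 := h3
      _ ≤ (Real.exp 2 * G) * N := mul_le_mul h4 h5 (sq_nonneg _) (by positivity)
      _ = _ := by ring
  have hGpos : 0 < G := by
    by_contra h
    have hG0' : G = 0 := le_antisymm (not_lt.1 h) hG0
    rw [hG0'] at hV2; simp at hV2; nlinarith
  -- the parameters `K₁`, `X`, the window length `ℓ`
  obtain ⟨K₁, hK₁⟩ : ∃ K₁ : ℝ, K₁ = 2 ^ 33 * (1 + Real.log N) * (1 + Real.log (3 + T)) := ⟨_, rfl⟩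
  have hlog3T : 0 ≤ Real.log (3 + T) := Real.log_nonneg (by linarith)
  have hK₁pos : 0 < K₁ := by rw [hK₁]; positivity
  have hK₁L : K₁ ^ 2 ≤ 2 ^ 66 * 81 * L ^ 4 := by
    have h := log_factor_le hN hT
    rw [← hL] at h
    have h0 : 0 ≤ (1 + Real.log N) * (1 + Real.log (3 + T)) := by positivity
    calc K₁ ^ 2 = 2 ^ 66 * ((1 + Real.log N) * (1 + Real.log (3 + T))) ^ 2 := by rw [hK₁]; ring
      _ ≤ 2 ^ 66 * (9 * L ^ 2) ^ 2 := by gcongr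
      _ = 2 ^ 66 * 81 * L ^ 4 := by ring
  obtain ⟨X, hX⟩ : ∃ X : ℝ, X = V ^ 2 / (2 * Real.exp 2 * G * K₁) := ⟨_, rfl⟩
  have hXpos : 0 < X := by rw [hX]; positivity
  have hXdef : 2 * Real.exp 2 * G * K₁ * X = V ^ 2 := by rw [hX]; field_simp
  obtain ⟨ℓ, hℓ⟩ : ∃ ℓ : ℝ, ℓ = if 6 ≤ X ^ 2 then X ^ 2 / 2 else Real.log N / 2 := ⟨_, rfl⟩
  have hℓpos : 0 < ℓ := by rw [hℓ]; split_ifs <;> positivity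
  -- windows
  obtain ⟨b, hb⟩ : ∃ b : ℝ, b = s₀.im - T := ⟨_, rfl⟩
  have hrange : ∀ s ∈ S, 0 ≤ s.im - b ∧ s.im - b ≤ 2 * T := by
    intro s hs
    rcases eq_or_ne s s₀ with rfl | hne
    · rw [hb]; constructor <;> linarith
    · have := (hsep s hs s₀ hs₀ hne).2
      rw [abs_le] at this; rw [hb]; constructor <;> linarith
  obtain ⟨idx, hidx⟩ : ∃ idx : ℂ → ℕ, idx = fun s ↦ ⌊(s.im - b) / ℓ⌋₊ := ⟨_, rfl⟩
  obtain ⟨Kw, hKw⟩ : ∃ Kw : ℕ, Kw = ⌊2 * T / ℓ⌋₊ + 1 := ⟨_, rfl⟩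
  have hmaps : ∀ s ∈ S, idx s ∈ Finset.range Kw := by
    intro s hs
    rw [Finset.mem_range, hKw, Nat.lt_succ_iff, hidx]
    exact Nat.floor_le_floor (div_le_div_of_nonneg_right (hrange s hs).2 hℓpos.le)
  -- each window
  have hwin : ∀ k ∈ Finset.range Kw,
      ((S.filter (fun s ↦ idx s = k)).card : ℝ) ≤ 2 * V⁻¹ ^ 2 * (Real.exp 2 * G) * N := by
    intro k _
    have hSkS : ∀ s ∈ S.filter (fun s ↦ idx s = k), s ∈ S := fun s hs ↦ (Finset.mem_filter.1 hs).1
    have hclose : ∀ r ∈ S.filter (fun s ↦ idx s = k), ∀ q ∈ S.filter (fun s ↦ idx s = k), |r.im - q.im| < ℓ := by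
      intro r hr q hq
      rw [Finset.mem_filter] at hr hq
      have := abs_sub_lt_of_floor_eq hℓpos (hrange r hr.1).1 (hrange q hq.1).1 (by
        have h1 := hr.2; have h2 := hq.2; rw [hidx] at h1 h2; exact h1.trans h2.symm)
      have e : r.im - b - (q.im - b) = r.im - q.im := by ring
      rwa [e] at this
    by_cases hcase : 6 ≤ X ^ 2
    · -- long windows: the proviso holds
      have hℓX : ℓ = X ^ 2 / 2 := by rw [hℓ, if_pos hcase]
      obtain ⟨B, hBdef⟩ : ∃ B : ℝ, B = K₁ * (3 + ℓ) ^ (1 / 2 : ℝ) := ⟨_, rfl⟩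
      have hB0 : 0 ≤ B := by rw [hBdef]; positivity
      have h := card_window_le (a := a) hN hV hB0 (S.filter (fun s ↦ idx s = k)) (fun s hs ↦ hre s (hSkS s hs))
        (fun s hs ↦ hlarge s (hSkS s hs)) (fun r hr q hq hrq ↦ ?_) ?_
      · rw [← hG] at h; exact h
      · -- scalar products
        obtain ⟨hr0, hr1⟩ := hre r (hSkS r hr)
        obtain ⟨hq0, hq1⟩ := hre q (hSkS q hq)
        obtain ⟨hsep1, hsep2⟩ := hsep r (hSkS r hr) q (hSkS q hq) hrq
        have hin := norm_inner_fVec_le hN hr0 hr1 hq0 hq1 (by rwa [abs_sub_comm])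
        refine hin.trans ?_
        have hlt := hclose r hr q hq
        rw [abs_sub_comm] at hlt
        have hqr : |q.im - r.im| ≤ T := by rwa [abs_sub_comm] at hsep2
        have hsq : (3 + |q.im - r.im|) ^ (1 / 2 : ℝ) ≤ (3 + ℓ) ^ (1 / 2 : ℝ) :=
          Real.rpow_le_rpow (by positivity) (by linarith) (by norm_num)
        have hlg : 1 + Real.log (3 + |q.im - r.im|) ≤ 1 + Real.log (3 + T) := by
          have := Real.log_le_log (by positivity : 0 < 3 + |q.im - r.im|) (by linarith : 3 + |q.im - r.im| ≤ 3 + T)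
          linarith
        have h0 : 0 ≤ 1 + Real.log (3 + |q.im - r.im|) := by
          have := Real.log_nonneg (show (1 : ℝ) ≤ 3 + |q.im - r.im| by linarith [abs_nonneg (q.im - r.im)])
          linarith
        have hlN : 0 ≤ 1 + Real.log N := by linarith
        calc 2 ^ 33 * (1 + Real.log N) * (3 + |q.im - r.im|) ^ (1 / 2 : ℝ) * (1 + Real.log (3 + |q.im - r.im|))
            ≤ 2 ^ 33 * (1 + Real.log N) * (3 + ℓ) ^ (1 / 2 : ℝ) * (1 + Real.log (3 + T)) :=
              mul_le_mul (mul_le_mul_of_nonneg_left hsq (by positivity)) hlg h0 (by positivity)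
          _ = B := by rw [hBdef, hK₁]; ring
      · -- the proviso `2 e² G B ≤ V²`: `(3+ℓ)^{1/2} ≤ X`
        have hsq : (3 + ℓ) ^ (1 / 2 : ℝ) ≤ X := by
          have : 3 + ℓ ≤ X ^ 2 := by rw [hℓX]; linarith
          calc (3 + ℓ) ^ (1 / 2 : ℝ) ≤ (X ^ 2) ^ (1 / 2 : ℝ) := Real.rpow_le_rpow (by positivity) this (by norm_num)
            _ = X := by rw [← Real.sqrt_eq_rpow, Real.sqrt_sq hXpos.le]
        rw [← hG]
        calc 2 * (Real.exp 2 * G) * B = 2 * Real.exp 2 * G * K₁ * (3 + ℓ) ^ (1 / 2 : ℝ) := by rw [hBdef]; ring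
          _ ≤ 2 * Real.exp 2 * G * K₁ * X := by gcongr
          _ = V ^ 2 := hXdef
    · -- short windows: single points, `B = 0`
      have hℓN : ℓ = Real.log N / 2 := by rw [hℓ, if_neg hcase]
      have h := card_window_le (a := a) hN hV le_rfl (S.filter (fun s ↦ idx s = k)) (fun s hs ↦ hre s (hSkS s hs))
        (fun s hs ↦ hlarge s (hSkS s hs)) (fun r hr q hq hrq ↦ ?_) (by simp; positivity)
      · rw [← hG] at h; exact h
      exfalso
      have h1 := (hsep r (hSkS r hr) q (hSkS q hq) hrq).1
      have h2 := hclose r hr q hq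
      rw [hℓN] at h2
      linarith
  -- sum over windows
  have hcard : (#S : ℝ) = ∑ k ∈ Finset.range Kw, ((S.filter (fun s ↦ idx s = k)).card : ℝ) := by
    rw [Finset.card_eq_sum_card_fiberwise hmaps]; push_cast; rfl
  have hKw' : (Kw : ℝ) ≤ 2 * T / ℓ + 1 := by
    rw [hKw]; push_cast
    have := Nat.floor_le (show 0 ≤ 2 * T / ℓ by positivity)
    linarith
  have hsum : (#S : ℝ) ≤ (2 * T / ℓ + 1) * (2 * V⁻¹ ^ 2 * (Real.exp 2 * G) * N) := by
    rw [hcard]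
    refine (Finset.sum_le_sum hwin).trans ?_
    rw [Finset.sum_const, Finset.card_range, nsmul_eq_mul]
    exact mul_le_mul_of_nonneg_right hKw' (by positivity)
  refine hsum.trans (lv_combine hG0 hN0 rfl ?_ (by positivity))
  -- the second term
  by_cases hcase : 6 ≤ X ^ 2
  · have hℓX : ℓ = X ^ 2 / 2 := by rw [hℓ, if_pos hcase]
    rw [hℓX]
    exact lv_caseA hGpos hK₁pos hV (by linarith) hN0 hX hK₁L
  · have hℓN : ℓ = Real.log N / 2 := by rw [hℓ, if_neg hcase]
    rw [hℓN]
    push Not at hcase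
    exact lv_caseB hGpos hK₁pos hV (by linarith) hN0 hlogN hX hK₁L hcase

end Final

end HuxleyLV

/-- **Discharge of `Literature.NumberTheory.LFunctions.Huxley1972_largeValues`.** [cite: Huxley1972, Ch. 27, Theorem (27.24)–(27.27)] -/
theorem Huxley1972_largeValues_holds : Huxley1972_largeValues := HuxleyLV.largeValues_holds

end Literature.NumberTheory.LFunctions

end
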